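import Literature.Barriers.Parity.SiegelZeroPrimePairsDegenerate
import Literature.Barriers.Parity.SiegelZeroPrimePairsFixedShift
import Literature.Barriers.Parity.SiegelZeroPrimePairsFixedShiftII
import HarnessLib

/-!
# Matomäki–Merikoski, Theorem 1.3: the §2/§7 reductions (dyadic smoothing, degenerate regimes) for a
# GENERAL second rate, and the classical (`exp(−c₀ √log X)`) pipeline to Corollary 1.1

Sibling of `Literature/Barriers/Parity/SiegelZeroPrimePairsDyadicSmoothing.lean` and
`Literature/Barriers/Parity/SiegelZeroPrimePairsDegenerate.lean`, which PROVE the reductions of §2 and of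
the first paragraph of §7 of Matomäki–Merikoski (IMRN 2023; arXiv:2112.11412) — Theorem 1.3
(`Literature.Barriers.Parity.MatomakiMerikoski2023_pairCorrelation`) from its smoothed dyadic form, and that
form from its core regime (even `h`, large `η`, normalised error) — with the error function of
Theorem 1.3 AS PRINTED, whose second rate is the Vinogradov–Korobov `exp(−C (log X)^{3/5−ε})`. The tree's proof of Lemma 2.4 (`SiegelZeroPrimePairsLemma24.lean`,
`MatomakiMerikoski2023_lemma24_classical`) uses the classical zero-free region of `ζ` and therefore
delivers the second rate in the classical form `exp(−c₀ √log X)` for ONE absolute `c₀ > 0`; §7 of the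
source run on that input yields the smoothed dyadic statement with the classical second rate, and
both corollaries only need that much (`MatomakiMerikoski2023_fixedShift_of_pairCorrelation_classical`,
`SiegelZeroPrimePairsFixedShift.lean`; `MatomakiMerikoski2023_fixedShift_ii_of_pairCorrelation_classical`,
`SiegelZeroPrimePairsFixedShiftII.lean`). This file supplies the missing link of that classical
pipeline. Everything here is PROVED; no definition and no named fact is introduced.

* `MMSmoothing.pairCorrelation_of_smoothed_generic` — the reduction of §2 ("we first decompose the
  summation condition `n ≤ X` dyadically … replace the condition `1_{n ∈ (x, 2x]}` by `g(n/x)` with an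
  error term `O(δx log² X) = O(X^{1−ε/2})`") for an ARBITRARY second rate: if the smoothed dyadic
  bound holds at every scale `x ≥ q^{37/4}` (`q ≥ 3`, `x^{−1/999}/4 ≤ δ ≤ min(x^{−1/1000}, 1/2)`,
  `1 ≤ h ≤ 3A x^{1+1/3999}`, weight `plateauCutoff (1+δ) (2−δ) δ`) with the error
  `K' (h/φ(h)) x (exp(−2C √(V' log η)) + R_h(x) + V' log⁶η/η)`, and the rates satisfy
  `R_h(x) ≤ R_c(X)` whenever `0.89 log X ≤ log x ≤ log X` (`X ≥ 1024`) and absorb power savings,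
  `X^{−1/8000} ≤ K_abs R_c(X)` (`X ≥ 3`), then for `X = q^V`, `V ≥ 10`, `1 ≤ h ≤ AX`:
  `|∑_{n ≤ X} Λ(n)Λ(n+h) − X 𝔖_h (1 + corr)| ≤ (K' + 30·24000³(3+A)K_abs) (h/φ(h)) X (exp(−C√(V log η)) + R_c(X) + V log⁶η/η)`
  (**proved**; the proof is that of `MatomakiMerikoski2023_pairCorrelation_of_smoothed'` verbatim —
  `δ = X^{−1/1000}/2`, `2^J ≍ X^{1/4000}`, trivial treatment of `n ≤ X/2^J` and of the smoothing
  cost, `∑_j x_j ∫g = X + O(δX + X/2^J)`, `𝔖_h ≤ 6h/φ(h)`, `|corr| ≤ 1` — with the second rate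
  kept abstract).
* `MMSmoothing.errorTerms13_dyadic_le` — the first and third rates at a dyadic scale
  (`exp(−2C√(V' log η)) ≤ exp(−C√(V log η))`, `V' ≤ V` for `V' ≥ 0.89·V/…`), split off from
  `MMSmoothing.errorTerms_dyadic_le`.
* `MMSmoothing.exists_rpow_neg_le_mul_exp_sqrt` — `X^{−κ} ≤ K exp(−c √log X)` (`X ≥ 3`).
* `MMSmoothing.smoothed_of_core_generic` — the degenerate regimes (§7, first paragraph: "Theorems 1.2
  and 1.3 are trivial unless `h` is even. Furthermore they follow from Lemma 3.1(i) with
  `w₁ = w₂ = X^{1/4}` and `m₁ = m₂ = 0` unless `η` is large") for an ARBITRARY second rate `R ≥ 0`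
  absorbing `x^{−1/1000} ≤ K_e R(x)`: the smoothed dyadic bound for all `h ≥ 1`, `η ≥ 10` follows
  from its restriction to even `h`, `η ≥ η₀` and `(log x/log q) log⁶η/η ≤ 1` (**proved**; the proof
  of `MMSmoothing.smoothed_of_core` verbatim with the second rate kept abstract: the sieve bound
  `PrimePairsVonMangoldt.sum_vonMangoldt_mul_shift_le`, the odd-shift bound, `𝔖(h) = 0` for odd `h`).
* `MatomakiMerikoski2023_smoothed_classical_of_core` — the classical instance of the previous item
  (`R(x) = exp(−c₀ √log x)`) in the quantifier shape `∀ C ≥ 1, ∀ A > 0, ∃ η₀ K, …` (**proved**).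
* `MatomakiMerikoski2023_pairCorrelation_classical_of_smoothed'` — the classical instance
  `R_h(x) = exp(−c₀ √log x)`, `R_c(X) = exp(−(c₀/2) √log X)` (`√log x ≥ √(0.89 log X) ≥ ½√log X`):
  the smoothed dyadic statement with the classical second rate, for all `C ≥ 1`, `A > 0`, implies
  Theorem 1.3 in the classical shape (hypothesis `h13` of
  `MatomakiMerikoski2023_fixedShift_of_pairCorrelation_classical`) with the constant `c₀/2` (**proved**).
* `MatomakiMerikoski2023_fixedShift_of_smoothed_classical`, `MatomakiMerikoski2023_fixedShift_of_core_classical`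
  — hence Corollary 1.1(i) (`MatomakiMerikoski2023_fixedShift`) from the classical smoothed dyadic
  statement, resp. from its core regime (**proved**, through `SiegelZeroPrimePairsFixedShift.lean`);
  `MatomakiMerikoski2023_fixedShift_ii_of_smoothed_classical`, `MatomakiMerikoski2023_fixedShift_ii_of_core_classical`
  — likewise Corollary 1.1(ii) (`MatomakiMerikoski2023_fixedShift_ii`), through
  `MatomakiMerikoski2023_fixedShift_ii_of_pairCorrelation_classical` (`SiegelZeroPrimePairsFixedShiftII.lean`)
  (**proved**).

So after this file the classical pipeline reads: core smoothed bound (even `h`, `η ≥ η₀`,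
`V' log⁶η/η ≤ 1`, second rate `exp(−c₀√log x)`; this is what (2.5), Lemmas 2.1–2.5, Proposition 2.3 and
§7 of the source address, with Lemma 2.4 in the tree's classical form) ⟹ Corollary 1.1(i), (ii).

## References

* K. Matomäki, J. Merikoski, IMRN 2023:23, 20337–20384 (arXiv:2112.11412), §2 "Initial steps",
  first two paragraphs; §7, first paragraph; Corollary 1.1 and its deduction after Theorem 1.4.
  [cite: MatomakiMerikoski2023, §2 and §7]
-/

noncomputable section

open Finset Real
open scoped ArithmeticFunction.vonMangoldt

namespace Literature.Barriers.Parity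

open Literature.NumberTheory.Sieve (goldbachSingularSeries plateauCutoff
  plateauCutoff_nonneg plateauCutoff_le_one sub_le_integral_plateauCutoff integral_plateauCutoff_le)
open Literature.NumberTheory.Sieve.PrimePairsVonMangoldt (sum_vonMangoldt_mul_shift_le
  sum_vonMangoldt_mul_shift_le_of_odd)

namespace MMSmoothing

/-- **The first and third rates of Theorem 1.3 at a dyadic scale**: if `0.89 log X ≤ log x ≤ log X`
(`log X > 0`), `η ≥ 10`, `C ≥ 0`, then with `V' = log x/log q`, `V = log X/log q` (`log q > 0`)
`exp(−2C√(V' log η)) + V' log⁶η/η ≤ exp(−C√(V log η)) + V log⁶η/η` (`4V' ≥ V`, `V' ≤ V`).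
[cite: MatomakiMerikoski2023, §7: "Hence now `q = X^{1/V'}` for some `V' ∈ [(1 − ε/2)V, V]`"] -/
theorem errorTerms13_dyadic_le {C x X q η : ℝ} (hC : 0 ≤ C) (hlogX : 0 < Real.log X)
    (hlow : 0.89 * Real.log X ≤ Real.log x) (hup : Real.log x ≤ Real.log X) (hq : 0 < Real.log q)
    (hη : 10 ≤ η) :
    Real.exp (-(2 * C) * Real.sqrt (Real.log x / Real.log q * Real.log η)) +
        Real.log x / Real.log q * Real.log η ^ (6 : ℕ) / η ≤
      Real.exp (-C * Real.sqrt (Real.log X / Real.log q * Real.log η)) +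
        Real.log X / Real.log q * Real.log η ^ (6 : ℕ) / η := by
  have hη0 : 0 < η := by linarith
  have hlogη : 0 < Real.log η := Real.log_pos (by linarith)
  have hlogx : 0 < Real.log x := by linarith
  have hV' : 0 ≤ Real.log x / Real.log q := by positivity
  -- term 1: `2√(V' log η) ≥ √(V log η)` since `4V' ≥ V`
  have h1 : Real.exp (-(2 * C) * Real.sqrt (Real.log x / Real.log q * Real.log η)) ≤
      Real.exp (-C * Real.sqrt (Real.log X / Real.log q * Real.log η)) := by
    refine Real.exp_le_exp.mpr ?_
    have hsq : Real.sqrt (Real.log X / Real.log q * Real.log η) ≤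
        2 * Real.sqrt (Real.log x / Real.log q * Real.log η) := by
      rw [show (2 : ℝ) = Real.sqrt 4 by rw [show (4 : ℝ) = 2 ^ 2 by norm_num, Real.sqrt_sq (by norm_num)],
        ← Real.sqrt_mul (by norm_num)]
      refine Real.sqrt_le_sqrt ?_
      have : Real.log X / Real.log q ≤ 4 * (Real.log x / Real.log q) := by
        rw [← mul_div_assoc]; exact div_le_div_of_nonneg_right (by linarith) hq.le
      nlinarith [hlogη.le]
    nlinarith [Real.sqrt_nonneg (Real.log x / Real.log q * Real.log η)]
  -- term 3
  have h3 : Real.log x / Real.log q * Real.log η ^ (6 : ℕ) / η ≤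
      Real.log X / Real.log q * Real.log η ^ (6 : ℕ) / η := by
    have : Real.log x / Real.log q ≤ Real.log X / Real.log q := div_le_div_of_nonneg_right hup hq.le
    have h6 : 0 ≤ Real.log η ^ (6 : ℕ) / η := by positivity
    calc Real.log x / Real.log q * Real.log η ^ (6 : ℕ) / η
        = Real.log x / Real.log q * (Real.log η ^ (6 : ℕ) / η) := by ring
      _ ≤ Real.log X / Real.log q * (Real.log η ^ (6 : ℕ) / η) := mul_le_mul_of_nonneg_right this h6
      _ = Real.log X / Real.log q * Real.log η ^ (6 : ℕ) / η := by ring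
  linarith

/-- **`X^{−κ} ≤ K exp(−c √log X)`** for all `X ≥ 3`, any `κ > 0` and `c`, with `K = K(κ, c)`:
the case `3/5 − ε = 1/2` of `exists_rpow_neg_le_mul_exp'`. [folklore] -/
theorem exists_rpow_neg_le_mul_exp_sqrt {κ : ℝ} (hκ0 : 0 < κ) (c : ℝ) :
    ∃ K : ℝ, 0 < K ∧ ∀ X : ℝ, 3 ≤ X → X ^ (-κ) ≤ K * Real.exp (-c * Real.sqrt (Real.log X)) := by
  obtain ⟨K, hK, hKX⟩ := exists_rpow_neg_le_mul_exp' hκ0 c (show (0 : ℝ) < 1 / 10 by norm_num)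
  refine ⟨K, hK, fun X hX => ?_⟩
  have h := hKX X hX
  have hexp : (3 / 5 - 1 / 10 : ℝ) = 1 / 2 := by norm_num
  rwa [hexp, ← Real.sqrt_eq_rpow] at h

set_option maxHeartbeats 800000 in
/-- **Matomäki–Merikoski §2, the dyadic smoothing reduction for a general second rate.** Fix
`C ≥ 0`, `A > 0`, `K' > 0`, rates `R_h, R_c : ℝ → ℝ` with `R_c ≥ 0` on `[3, ∞)`,
`R_h(x) ≤ R_c(X)` whenever `X ≥ 1024` and `0.89 log X ≤ log x ≤ log X`, and
`X^{−1/8000} ≤ K_abs R_c(X)` for `X ≥ 3`. If for every primitive quadratic `χ` mod `q ≥ 3` with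
`L(1 − 1/(η log q), χ) = 0`, `η ≥ 10`, every `x ≥ q^{37/4}`, every
`x^{−1/999}/4 ≤ δ ≤ min(x^{−1/1000}, 1/2)` and every `1 ≤ h ≤ 3A x^{1+1/3999}`,
`|∑_n g(n/x)Λ(n)Λ(n+h) − x (∫ g) 𝔖_h (1 + corr)| ≤ K' (h/φ(h)) x (exp(−2C√(V' log η)) + R_h(x) + V' log⁶η/η)`
(`g = plateauCutoff (1+δ) (2−δ) δ`, `V' = log x/log q`, `corr` the correction factor of
Theorem 1.3), then for every primitive quadratic `χ` mod `q ≥ 2` with such a zero, `X = q^V`,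
`V ≥ 10` and `1 ≤ h ≤ AX`:
`|∑_{n ≤ X} Λ(n)Λ(n+h) − X 𝔖_h (1 + corr)| ≤ (K' + 30·24000³(3+A) K_abs) (h/φ(h)) X (exp(−C√(V log η)) + R_c(X) + V log⁶η/η)`.
Proof exactly as for `MatomakiMerikoski2023_pairCorrelation_of_smoothed'` (§2 of the source:
`δ = X^{−1/1000}/2`, dyadic blocks `(X/2^{j+1}, X/2^j]`, `j < J`, `2^J ≍ X^{1/4000}`, trivial
bounds `Λ ≤ log` on `n ≤ X/2^J` and on the `≤ 2δx + 2` integers where `g(n/x) ≠ 1_{(x,2x]}(n)`,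
the hypothesis on each block, `∑_j x_j ∫ g = X + O(δX + X/2^J)`, `𝔖_h ≤ 6h/φ(h)`, `|corr| ≤ 1`,
`errorTerms13_dyadic_le` and the assumed comparison of the second rates, and all power savings
`≪_A (h/φ(h)) X^{1−1/8000}` absorbed by the assumed `X^{−1/8000} ≤ K_abs R_c(X)`).
[cite: MatomakiMerikoski2023, §2] -/
theorem pairCorrelation_of_smoothed_generic {C A K' Kabs : ℝ} (hC : 0 ≤ C) (hA : 0 < A)
    (hK' : 0 < K') (hKabs : 0 < Kabs) {Rh Rc : ℝ → ℝ} (hRc0 : ∀ X : ℝ, 3 ≤ X → 0 ≤ Rc X)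
    (hR : ∀ x X : ℝ, 1024 ≤ X → 0.89 * Real.log X ≤ Real.log x → Real.log x ≤ Real.log X →
      Rh x ≤ Rc X)
    (Habs : ∀ X : ℝ, 3 ≤ X → X ^ (-(1 / 8000 : ℝ)) ≤ Kabs * Rc X)
    (H' : ∀ (q : ℕ) [NeZero q], 3 ≤ q → ∀ χ : DirichletCharacter ℂ q, χ.IsPrimitive → χ.IsQuadratic →
        ∀ η : ℝ, 10 ≤ η → χ.LFunction ((1 - 1 / (η * Real.log q) : ℝ) : ℂ) = 0 →
          ∀ x : ℝ, (q : ℝ) ^ (37 / 4 : ℝ) ≤ x →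
            ∀ δ : ℝ, x ^ (-(1 / 999 : ℝ)) / 4 ≤ δ → δ ≤ x ^ (-(1 / 1000 : ℝ)) → δ ≤ 1 / 2 →
            ∀ h : ℕ, 1 ≤ h → (h : ℝ) ≤ 3 * A * x ^ (1 + 1 / 3999 : ℝ) →
              |(∑ n ∈ Icc 1 ⌊2 * x⌋₊,
                  plateauCutoff (1 + δ) (2 - δ) δ (n / x) * (Λ n * Λ (n + h))) -
                  x * (∫ u, plateauCutoff (1 + δ) (2 - δ) δ u) * goldbachSingularSeries h *
                    (1 + if Nat.totient (2 ^ padicValNat 2 q) ∣ h then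
                          (-1 : ℝ) ^ (h / Nat.totient (2 ^ padicValNat 2 q)) *
                            ∏ p ∈ (q / 2 ^ padicValNat 2 q).primeFactors.filter (fun p => ¬ p ∣ h),
                              (-1 : ℝ) / ((p : ℝ) - 2)
                        else 0)| ≤
                K' * ((h : ℝ) / (Nat.totient h : ℝ)) * x *
                  (Real.exp (-(2 * C) * Real.sqrt (Real.log x / Real.log q * Real.log η)) +
                    Rh x + Real.log x / Real.log q * Real.log η ^ (6 : ℕ) / η)) :
    ∀ (q : ℕ) [NeZero q], 2 ≤ q → ∀ χ : DirichletCharacter ℂ q, χ.IsPrimitive → χ.IsQuadratic →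
      ∀ η : ℝ, 10 ≤ η → χ.LFunction ((1 - 1 / (η * Real.log q) : ℝ) : ℂ) = 0 →
        ∀ V X : ℝ, 10 ≤ V → X = (q : ℝ) ^ V → ∀ h : ℕ, 1 ≤ h → (h : ℝ) ≤ A * X →
          |(∑ n ∈ Icc 1 ⌊X⌋₊, Λ n * Λ (n + h)) -
              X * goldbachSingularSeries h *
                (1 + if Nat.totient (2 ^ padicValNat 2 q) ∣ h then
                      (-1 : ℝ) ^ (h / Nat.totient (2 ^ padicValNat 2 q)) *
                        ∏ p ∈ (q / 2 ^ padicValNat 2 q).primeFactors.filter (fun p => ¬ p ∣ h),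
                          (-1 : ℝ) / ((p : ℝ) - 2)
                    else 0)| ≤
            (K' + 30 * 24000 ^ 3 * (3 + A) * Kabs) * ((h : ℝ) / (Nat.totient h : ℝ)) * X *
              (Real.exp (-C * Real.sqrt (V * Real.log η)) + Rc X +
                V * Real.log η ^ (6 : ℕ) / η) := by
  intro q _ hq χ hprim hquad η hη hL V X hV hX h hh hhA
  set KA : ℝ := 30 * 24000 ^ 3 * (3 + A) with hKA
  have hKA0 : 0 < KA := by positivity
  -- `q = 2` carries no primitive character
  by_cases hq2eq : q = 2
  · subst hq2eq; exact absurd hprim (not_isPrimitive_level_two χ)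
  have hq3 : 3 ≤ q := by omega
  have hq3' : (3 : ℝ) ≤ q := by exact_mod_cast hq3
  -- the correction factor and the singular series
  set corr : ℝ := (if Nat.totient (2 ^ padicValNat 2 q) ∣ h then
      (-1 : ℝ) ^ (h / Nat.totient (2 ^ padicValNat 2 q)) *
        ∏ p ∈ (q / 2 ^ padicValNat 2 q).primeFactors.filter (fun p => ¬ p ∣ h),
          (-1 : ℝ) / ((p : ℝ) - 2)
      else 0) with hcorr_def
  have hcorr : |corr| ≤ 1 := abs_corr_le_one q h
  have hcorr1 : |1 + corr| ≤ 2 := by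
    have := abs_add_le (1 : ℝ) corr; rw [abs_one] at this; linarith
  set hφ : ℝ := (h : ℝ) / (Nat.totient h : ℝ) with hhφ
  have hh0 : h ≠ 0 := by omega
  have hφpos : (0 : ℝ) < Nat.totient h := by exact_mod_cast Nat.totient_pos.mpr (by omega)
  have hhφ1 : 1 ≤ hφ := by rw [hhφ, le_div_iff₀ hφpos, one_mul]; exact_mod_cast Nat.totient_le h
  set 𝔖 : ℝ := goldbachSingularSeries h with h𝔖
  have h𝔖0 : 0 ≤ 𝔖 := Literature.NumberTheory.Sieve.SingularSeriesMean.goldbachSingularSeries_nonneg h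
  have h𝔖le : 𝔖 ≤ 6 * hφ := goldbachSingularSeries_le_mul_div_totient hh0
  -- basic sizes
  have hq2 : (2 : ℝ) ≤ q := by exact_mod_cast hq
  have hq0 : (0 : ℝ) < q := by linarith
  have hq1 : (1 : ℝ) ≤ q := by linarith
  have hlogq : 0 < Real.log q := Real.log_pos (by linarith)
  have hlog2 : Real.log 2 ≤ Real.log q := Real.log_le_log two_pos hq2
  have hlog2pos : 0 < Real.log 2 := Real.log_pos one_lt_two
  have hV0 : 0 < V := by linarith
  have hX0 : 0 < X := by rw [hX]; exact Real.rpow_pos_of_pos hq0 V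
  have hlogX : Real.log X = V * Real.log q := by rw [hX, Real.log_rpow hq0]
  have hlogXge : 10 * Real.log 2 ≤ Real.log X := by
    rw [hlogX]; exact mul_le_mul hV hlog2 hlog2pos.le (by linarith)
  have hlogX0 : 0 < Real.log X := by linarith only [hlogXge, hlog2pos]
  have hlog2d : (0.6931471803 : ℝ) < Real.log 2 := Real.log_two_gt_d9
  have hX1024 : (1024 : ℝ) ≤ X := by
    have h1 : Real.log 1024 = 10 * Real.log 2 := by
      rw [show (1024 : ℝ) = 2 ^ 10 by norm_num, Real.log_pow]; norm_num
    have h2 : Real.log 1024 ≤ Real.log X := by rw [h1]; exact hlogXge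
    exact (Real.log_le_log_iff (by norm_num) hX0).mp h2
  have hX3 : (3 : ℝ) ≤ X := by linarith
  have hX1 : (1 : ℝ) ≤ X := by linarith
  have hVeq : V = Real.log X / Real.log q := by rw [hlogX]; field_simp
  -- the summand and its trivial bound
  set a : ℕ → ℝ := fun n => Λ n * Λ (n + h) with ha_def
  have ha0 : ∀ n, 0 ≤ a n := fun n => vonMangoldt_mul_nonneg n (n + h)
  set L : ℝ := Real.log ((3 + A) * X) with hL_def
  have h3AX : 3 ≤ (3 + A) * X := by
    have e : (3 + A) * X = 3 * X + A * X := by ring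
    have hAX : 0 ≤ A * X := by positivity
    rw [e]; linarith only [hX1, hAX]
  have hL1 : 1 ≤ L := by
    rw [hL_def, ← Real.log_exp 1]
    refine Real.log_le_log (Real.exp_pos 1) (le_trans ?_ h3AX)
    linarith [Real.exp_one_lt_d9]
  have hL0 : 0 < L := by linarith
  have haL : ∀ n : ℕ, 1 ≤ n → (n : ℝ) ≤ 2 * X → a n ≤ L ^ 2 := by
    intro n hn1 hn2
    refine vonMangoldt_mul_le_log_sq ?_ hn1
    have e : (3 + A) * X = 2 * X + A * X + X := by ring
    rw [e]
    linarith only [hn2, hhA, hX0]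
  -- the parameters `δ` and `J`
  set δ : ℝ := X ^ (-(1 / 1000 : ℝ)) / 2 with hδ_def
  have hXpow : X ^ (-(1 / 1000 : ℝ)) ≤ 1 := Real.rpow_le_one_of_one_le_of_nonpos hX1 (by norm_num)
  have hXpow0 : 0 < X ^ (-(1 / 1000 : ℝ)) := Real.rpow_pos_of_pos hX0 _
  have hδ0 : 0 < δ := by positivity
  have hδhalf : δ ≤ 1 / 2 := by rw [hδ_def]; linarith
  have hδX : 2 * δ * X = X ^ (999 / 1000 : ℝ) := by
    rw [hδ_def, show (999 / 1000 : ℝ) = -(1 / 1000) + 1 by norm_num, Real.rpow_add hX0, Real.rpow_one]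
    ring
  set t : ℝ := Real.log X / (4000 * Real.log 2) with ht_def
  have ht0 : 0 ≤ t := by positivity
  set J : ℕ := ⌊t⌋₊ + 1 with hJ_def
  have h2t : (2 : ℝ) ^ t = X ^ (1 / 4000 : ℝ) := by
    rw [Real.rpow_def_of_pos two_pos, Real.rpow_def_of_pos hX0, ht_def]
    congr 1; field_simp
  have h2J_gt : X ^ (1 / 4000 : ℝ) < (2 : ℝ) ^ J := by
    rw [← h2t, ← Real.rpow_natCast 2 J]
    refine Real.rpow_lt_rpow_of_exponent_lt one_lt_two ?_
    rw [hJ_def]; push_cast; exact Nat.lt_floor_add_one t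
  have h2J_le : (2 : ℝ) ^ J ≤ 2 * X ^ (1 / 4000 : ℝ) := by
    rw [← h2t, hJ_def, pow_succ, mul_comm, ← Real.rpow_natCast 2 ⌊t⌋₊]
    exact mul_le_mul_of_nonneg_left (Real.rpow_le_rpow_of_exponent_le one_le_two (Nat.floor_le ht0)) two_pos.le
  have h2J_pos : (0 : ℝ) < 2 ^ J := pow_pos two_pos J
  have hXJ : X / 2 ^ J < X ^ (3999 / 4000 : ℝ) := by
    rw [div_lt_iff₀ h2J_pos]
    calc X = X ^ (3999 / 4000 : ℝ) * X ^ (1 / 4000 : ℝ) := by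
          rw [← Real.rpow_add hX0, show (3999 / 4000 : ℝ) + 1 / 4000 = 1 by norm_num, Real.rpow_one]
      _ < X ^ (3999 / 4000 : ℝ) * 2 ^ J := mul_lt_mul_of_pos_left h2J_gt (Real.rpow_pos_of_pos hX0 _)
  have hJL : (J : ℝ) ≤ 2 * L := by
    have h1 : (J : ℝ) ≤ t + 1 := by
      rw [hJ_def]; push_cast; linarith [Nat.floor_le ht0]
    have h2 : t ≤ Real.log X := by
      rw [ht_def, div_le_iff₀ (by positivity)]
      have h400 : (1 : ℝ) ≤ 4000 * Real.log 2 := by linarith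
      exact le_mul_of_one_le_right hlogX0.le h400
    have h3 : Real.log X ≤ L := by
      rw [hL_def]; refine Real.log_le_log hX0 ?_
      have e : (3 + A) * X = X + (2 + A) * X := by ring
      have hAX : 0 ≤ (2 + A) * X := by positivity
      rw [e]; linarith only [hAX]
    linarith only [h1, h2, h3, hL1]
  -- the common error function
  set E : ℝ := Real.exp (-C * Real.sqrt (V * Real.log η)) + Rc X +
    V * Real.log η ^ (6 : ℕ) / η with hE_def
  have hη0 : 0 < η := by linarith
  have hV6 : 0 ≤ V * Real.log η ^ (6 : ℕ) / η := by
    have := Real.log_nonneg (show (1:ℝ) ≤ η by linarith); positivity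
  have hRcX : 0 ≤ Rc X := hRc0 X hX3
  have hEexp : Rc X ≤ E := by
    rw [hE_def]
    linarith [Real.exp_pos (-C * Real.sqrt (V * Real.log η))]
  have hE0 : 0 ≤ E := hRcX.trans hEexp
  -- the weight and its integral
  set g : ℝ → ℝ := plateauCutoff (1 + δ) (2 - δ) δ with hg_def
  have hab : 1 + δ ≤ 2 - δ := by linarith
  set I : ℝ := ∫ u, g u with hI_def
  have hI1 : I ≤ 1 := by
    have := integral_plateauCutoff_le hδ0 hab; rw [← hg_def] at this; linarith
  have hI2 : 1 - 2 * δ ≤ I := by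
    have := sub_le_integral_plateauCutoff hδ0 hab; rw [← hg_def] at this; linarith
  have hI0 : 0 ≤ I := by linarith
  -- the blocks
  have hblock : ∀ j ∈ Finset.range J,
      |(∑ n ∈ Ioc ⌊X / 2 ^ (j + 1)⌋₊ ⌊X / 2 ^ j⌋₊, a n) -
          X / 2 ^ (j + 1) * I * 𝔖 * (1 + corr)| ≤
        (2 * δ * (X / 2 ^ (j + 1)) + 2) * L ^ 2 + K' * hφ * (X / 2 ^ (j + 1)) * E := by
    intro j hj
    have hjJ : j + 1 ≤ J := Finset.mem_range.mp hj
    set x : ℝ := X / 2 ^ (j + 1) with hx_def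
    have h2j : (0 : ℝ) < 2 ^ (j + 1) := pow_pos two_pos _
    have hx2 : 2 * x = X / 2 ^ j := by rw [hx_def, pow_succ]; field_simp
    have hxX : x ≤ X / 2 := by
      rw [hx_def, div_le_div_iff_of_pos_left hX0 h2j two_pos]
      calc (2 : ℝ) = 2 ^ 1 := by norm_num
        _ ≤ 2 ^ (j + 1) := pow_le_pow_right₀ one_le_two (by omega)
    have hxlow : X ^ (3999 / 4000 : ℝ) / 2 ≤ x := by
      -- `x = X/2^{j+1} ≥ X/2^J ≥ X^{3999/4000}/2`
      have h1 : X / 2 ^ J ≤ x := by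
        rw [hx_def]
        exact div_le_div_of_nonneg_left hX0.le h2j (pow_le_pow_right₀ one_le_two hjJ)
      have h2 : X ^ (3999 / 4000 : ℝ) / 2 ≤ X / 2 ^ J := by
        rw [div_le_div_iff₀ two_pos h2J_pos]
        calc X ^ (3999 / 4000 : ℝ) * 2 ^ J ≤ X ^ (3999 / 4000 : ℝ) * (2 * X ^ (1 / 4000 : ℝ)) :=
              mul_le_mul_of_nonneg_left h2J_le (Real.rpow_nonneg hX0.le _)
          _ = X * 2 := by
              rw [mul_comm (2 : ℝ), ← mul_assoc, ← Real.rpow_add hX0,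
                show (3999 / 4000 : ℝ) + 1 / 4000 = 1 by norm_num, Real.rpow_one]
      exact h2.trans h1
    have hX399 : 0 < X ^ (3999 / 4000 : ℝ) := Real.rpow_pos_of_pos hX0 _
    have hx0 : 0 < x := by linarith
    have hx1 : 1 ≤ x := by
      -- `X^{399/400} ≥ 1024^{399/400} ≥ 2`
      have : (2 : ℝ) ≤ X ^ (3999 / 4000 : ℝ) := by
        calc (2 : ℝ) ≤ 1024 ^ (3999 / 4000 : ℝ) := by
              have : (2 : ℝ) = 1024 ^ (1 / 10 : ℝ) := by
                rw [show (1024 : ℝ) = 2 ^ (10 : ℝ) by norm_num, ← Real.rpow_mul (by norm_num)]; norm_num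
              rw [this]
              exact Real.rpow_le_rpow_of_exponent_le (by norm_num) (by norm_num)
          _ ≤ X ^ (3999 / 4000 : ℝ) := Real.rpow_le_rpow (by norm_num) hX1024 (by norm_num)
      linarith only [this, hxlow]
    -- (x2) `q^{37/4} ≤ x` (uses `q ≥ 3`: `2 ≤ 3^{7/10} ≤ q^{7/10}`)
    have hq8 : (q : ℝ) ^ (37 / 4 : ℝ) ≤ x := by
      have h1 : X ^ (3999 / 4000 : ℝ) = (q : ℝ) ^ (V * (3999 / 4000)) := by
        rw [hX, ← Real.rpow_mul hq0.le]
      have h2 : (q : ℝ) ^ (37 / 4 : ℝ) * 2 ≤ (q : ℝ) ^ (V * (3999 / 4000)) := by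
        have h3 : (q : ℝ) ^ ((37 / 4 : ℝ) + 7 / 10) ≤ (q : ℝ) ^ (V * (3999 / 4000)) :=
          Real.rpow_le_rpow_of_exponent_le hq1 (by linarith only [hV])
        rw [Real.rpow_add hq0] at h3
        have h4 : (2 : ℝ) ≤ (q : ℝ) ^ (7 / 10 : ℝ) :=
          calc (2 : ℝ) = ((2 : ℝ) ^ (10 : ℕ)) ^ (1 / 10 : ℝ) := by
                rw [← Real.rpow_natCast, ← Real.rpow_mul (by norm_num)]; norm_num
            _ ≤ ((3 : ℝ) ^ (7 : ℕ)) ^ (1 / 10 : ℝ) := Real.rpow_le_rpow (by norm_num) (by norm_num) (by norm_num)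
            _ = (3 : ℝ) ^ (7 / 10 : ℝ) := by
                rw [← Real.rpow_natCast, ← Real.rpow_mul (by norm_num)]; norm_num
            _ ≤ (q : ℝ) ^ (7 / 10 : ℝ) := Real.rpow_le_rpow (by norm_num) hq3' (by norm_num)
        have h5 : 0 ≤ (q : ℝ) ^ (37 / 4 : ℝ) := Real.rpow_nonneg hq0.le _
        exact (mul_le_mul_of_nonneg_left h4 h5).trans h3
      rw [← h1] at h2
      linarith only [h2, hxlow]
    -- (x3) the range of `δ`
    have hδlow : x ^ (-(1 / 999 : ℝ)) / 4 ≤ δ := by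
      rw [hδ_def]
      -- `x^{-1/999} ≤ (X^{3999/4000}/2)^{-1/999} = 2^{1/999} X^{-3999/3996000} ≤ 2 X^{-1/1000}`
      have h1 : x ^ (-(1 / 999 : ℝ)) ≤ (X ^ (3999 / 4000 : ℝ) / 2) ^ (-(1 / 999 : ℝ)) :=
        Real.rpow_le_rpow_of_nonpos (by positivity) hxlow (by norm_num)
      have h2 : (X ^ (3999 / 4000 : ℝ) / 2) ^ (-(1 / 999 : ℝ)) =
          X ^ (-(3999 / 3996000 : ℝ)) * 2 ^ (1 / 999 : ℝ) := by
        rw [Real.div_rpow (Real.rpow_nonneg hX0.le _) two_pos.le, ← Real.rpow_mul hX0.le,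
          div_eq_mul_inv, ← Real.rpow_neg two_pos.le]
        norm_num
      have h3 : (2 : ℝ) ^ (1 / 999 : ℝ) ≤ 2 :=
        calc (2 : ℝ) ^ (1 / 999 : ℝ) ≤ 2 ^ (1 : ℝ) := Real.rpow_le_rpow_of_exponent_le one_le_two (by norm_num)
          _ = 2 := Real.rpow_one 2
      have h4 : X ^ (-(3999 / 3996000 : ℝ)) ≤ X ^ (-(1 / 1000 : ℝ)) :=
        Real.rpow_le_rpow_of_exponent_le hX1 (by norm_num)
      have h5 : 0 ≤ X ^ (-(3999 / 3996000 : ℝ)) := Real.rpow_nonneg hX0.le _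
      have h6 : x ^ (-(1 / 999 : ℝ)) ≤ X ^ (-(1 / 1000 : ℝ)) * 2 := by
        rw [h2] at h1
        exact h1.trans (mul_le_mul h4 h3 (Real.rpow_nonneg two_pos.le _) (Real.rpow_nonneg hX0.le _))
      linarith only [h6]
    have hδup : δ ≤ x ^ (-(1 / 1000 : ℝ)) := by
      rw [hδ_def]
      have h1 : X ^ (-(1 / 1000 : ℝ)) ≤ x ^ (-(1 / 1000 : ℝ)) :=
        Real.rpow_le_rpow_of_nonpos hx0 (hxX.trans (half_le_self hX0.le)) (by norm_num)
      have h2 : 0 ≤ X ^ (-(1 / 1000 : ℝ)) := Real.rpow_nonneg hX0.le _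
      linarith only [h1, h2]
    -- (x4) the range of `h`
    have hhx : (h : ℝ) ≤ 3 * A * x ^ (1 + 1 / 3999 : ℝ) := by
      -- `X ≤ (2x)^{4000/3999} ≤ 3 x^{1+1/3999}`
      have h1 : X ≤ (2 * x) ^ (4000 / 3999 : ℝ) := by
        have h2x : X ^ (3999 / 4000 : ℝ) ≤ 2 * x := by linarith only [hxlow]
        have := Real.rpow_le_rpow (Real.rpow_nonneg hX0.le _) h2x (show (0:ℝ) ≤ 4000 / 3999 by norm_num)
        rwa [← Real.rpow_mul hX0.le, show (3999 / 4000 : ℝ) * (4000 / 3999) = 1 by norm_num, Real.rpow_one] at this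
      have h2 : (2 * x) ^ (4000 / 3999 : ℝ) ≤ 3 * x ^ (1 + 1 / 3999 : ℝ) := by
        rw [Real.mul_rpow two_pos.le hx0.le]
        have h3 : (2 : ℝ) ^ (4000 / 3999 : ℝ) ≤ 3 := by
          calc (2 : ℝ) ^ (4000 / 3999 : ℝ) ≤ 2 ^ (3 / 2 : ℝ) :=
                Real.rpow_le_rpow_of_exponent_le one_le_two (by norm_num)
            _ = 2 * Real.sqrt 2 := by
                rw [show (3 / 2 : ℝ) = 1 + 1 / 2 by norm_num, Real.rpow_add two_pos, Real.rpow_one,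
                  Real.sqrt_eq_rpow]
            _ ≤ 2 * (3 / 2) := by
                have : Real.sqrt 2 ≤ 3 / 2 := by
                  rw [Real.sqrt_le_left (by norm_num)]; norm_num
                linarith only [this]
            _ = 3 := by norm_num
        have h4 : x ^ (4000 / 3999 : ℝ) ≤ x ^ (1 + 1 / 3999 : ℝ) :=
          Real.rpow_le_rpow_of_exponent_le hx1 (by norm_num)
        have h5 : 0 ≤ x ^ (4000 / 3999 : ℝ) := Real.rpow_nonneg hx0.le _
        calc (2 : ℝ) ^ (4000 / 3999 : ℝ) * x ^ (4000 / 3999 : ℝ) ≤ 3 * x ^ (4000 / 3999 : ℝ) :=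
              mul_le_mul_of_nonneg_right h3 h5
          _ ≤ 3 * x ^ (1 + 1 / 3999 : ℝ) := by linarith only [h4]
      calc (h : ℝ) ≤ A * X := hhA
        _ ≤ A * (3 * x ^ (1 + 1 / 3999 : ℝ)) := mul_le_mul_of_nonneg_left (h1.trans h2) hA.le
        _ = 3 * A * x ^ (1 + 1 / 3999 : ℝ) := by ring
    -- (x5) the logarithms
    have hlogx_up : Real.log x ≤ Real.log X := Real.log_le_log hx0 (hxX.trans (half_le_self hX0.le))
    have hlogx_low : 0.89 * Real.log X ≤ Real.log x := by
      have h1 : Real.log (X ^ (3999 / 4000 : ℝ) / 2) ≤ Real.log x := Real.log_le_log (by positivity) hxlow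
      rw [Real.log_div hX399.ne' two_ne_zero, Real.log_rpow hX0] at h1
      linarith only [h1, hlogXge, hlogX0]
    -- (x6) smoothing the block
    have hsmooth : |(∑ n ∈ Ioc ⌊x⌋₊ ⌊2 * x⌋₊, a n) - ∑ n ∈ Icc 1 ⌊2 * x⌋₊, g (n / x) * a n| ≤
        (2 * δ * x + 2) * L ^ 2 :=
      abs_sum_Ioc_sub_sum_smooth_le hx1 hδ0 hδhalf ha0 fun n hn => by
        obtain ⟨hn1, hn2⟩ := Finset.mem_Icc.mp hn
        refine haL n hn1 (le_trans ?_ (show 2 * x ≤ 2 * X by linarith only [hxX, hX0]))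
        exact le_trans (by exact_mod_cast hn2) (Nat.floor_le (by positivity))
    -- (x7) the hypothesis on the block
    have hHx := H' q hq3 χ hprim hquad η hη hL x hq8 δ hδlow hδup hδhalf h hh hhx
    have hEx : Real.exp (-(2 * C) * Real.sqrt (Real.log x / Real.log q * Real.log η)) + Rh x +
        Real.log x / Real.log q * Real.log η ^ (6 : ℕ) / η ≤ E := by
      have h13 := errorTerms13_dyadic_le hC hlogX0 hlogx_low hlogx_up hlogq hη
      have h2 := hR x X hX1024 hlogx_low hlogx_up
      rw [hE_def, hVeq]
      linarith
    have hmain : |(∑ n ∈ Icc 1 ⌊2 * x⌋₊, g (n / x) * a n) - x * I * 𝔖 * (1 + corr)| ≤ K' * hφ * x * E := by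
      refine hHx.trans ?_
      exact mul_le_mul_of_nonneg_left hEx (by positivity)
    -- combine
    rw [show ⌊X / 2 ^ j⌋₊ = ⌊2 * x⌋₊ by rw [hx2]]
    calc |(∑ n ∈ Ioc ⌊x⌋₊ ⌊2 * x⌋₊, a n) - x * I * 𝔖 * (1 + corr)|
        ≤ |(∑ n ∈ Ioc ⌊x⌋₊ ⌊2 * x⌋₊, a n) - ∑ n ∈ Icc 1 ⌊2 * x⌋₊, g (n / x) * a n| +
            |(∑ n ∈ Icc 1 ⌊2 * x⌋₊, g (n / x) * a n) - x * I * 𝔖 * (1 + corr)| := abs_sub_le _ _ _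
      _ ≤ (2 * δ * x + 2) * L ^ 2 + K' * hφ * x * E := add_le_add hsmooth hmain
  -- summing the blocks
  have hsumx : ∑ j ∈ Finset.range J, X / 2 ^ (j + 1) = X - X / 2 ^ J := sum_dyadic_scales X J
  have hXJ0 : 0 ≤ X / 2 ^ J := by positivity
  have hblocks : |(∑ j ∈ Finset.range J, ∑ n ∈ Ioc ⌊X / 2 ^ (j + 1)⌋₊ ⌊X / 2 ^ j⌋₊, a n) -
      (X - X / 2 ^ J) * I * 𝔖 * (1 + corr)| ≤ (2 * δ * X + 2 * J) * L ^ 2 + K' * hφ * X * E := by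
    have hrew : (X - X / 2 ^ J) * I * 𝔖 * (1 + corr) =
        ∑ j ∈ Finset.range J, X / 2 ^ (j + 1) * I * 𝔖 * (1 + corr) := by
      rw [← hsumx, Finset.sum_mul, Finset.sum_mul, Finset.sum_mul]
    rw [hrew, ← Finset.sum_sub_distrib]
    refine (Finset.abs_sum_le_sum_abs _ _).trans ?_
    refine (Finset.sum_le_sum hblock).trans ?_
    rw [Finset.sum_add_distrib]
    have h1 : ∑ j ∈ Finset.range J, (2 * δ * (X / 2 ^ (j + 1)) + 2) * L ^ 2 =
        (2 * δ * (X - X / 2 ^ J) + 2 * J) * L ^ 2 := by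
      rw [← Finset.sum_mul, Finset.sum_add_distrib, ← Finset.mul_sum, hsumx, Finset.sum_const,
        Finset.card_range, nsmul_eq_mul]
      ring
    have h2 : ∑ j ∈ Finset.range J, K' * hφ * (X / 2 ^ (j + 1)) * E = K' * hφ * (X - X / 2 ^ J) * E := by
      rw [← hsumx, Finset.mul_sum, Finset.sum_mul]
    rw [h1, h2]
    have h3 : 0 ≤ K' * hφ * E := by positivity
    have h4 : 0 ≤ 2 * δ * L ^ 2 := by positivity
    have h5 : (2 * δ * (X - X / 2 ^ J) + 2 * J) * L ^ 2 ≤ (2 * δ * X + 2 * J) * L ^ 2 := by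
      refine mul_le_mul_of_nonneg_right ?_ (by positivity)
      have : 0 ≤ 2 * δ * (X / 2 ^ J) := by positivity
      linarith only [this]
    have h6 : K' * hφ * (X - X / 2 ^ J) * E ≤ K' * hφ * X * E := by
      refine mul_le_mul_of_nonneg_right (mul_le_mul_of_nonneg_left ?_ (by positivity)) hE0
      linarith only [hXJ0]
    exact add_le_add h5 h6
  -- the initial segment
  have hinit : |∑ n ∈ Icc 1 ⌊X / 2 ^ J⌋₊, a n| ≤ X ^ (3999 / 4000 : ℝ) * L ^ 2 := by
    rw [abs_of_nonneg (Finset.sum_nonneg fun n _ => ha0 n)]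
    calc ∑ n ∈ Icc 1 ⌊X / 2 ^ J⌋₊, a n ≤ ∑ n ∈ Icc 1 ⌊X / 2 ^ J⌋₊, L ^ 2 := by
          refine Finset.sum_le_sum fun n hn => ?_
          obtain ⟨hn1, hn2⟩ := Finset.mem_Icc.mp hn
          refine haL n hn1 (le_trans (le_trans (by exact_mod_cast hn2) (Nat.floor_le hXJ0)) ?_)
          have : X / 2 ^ J ≤ X := div_le_self hX0.le (one_le_pow₀ one_le_two)
          linarith only [this, hX0]
      _ = (⌊X / 2 ^ J⌋₊ : ℝ) * L ^ 2 := by rw [Finset.sum_const, Nat.card_Icc, nsmul_eq_mul]; simp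
      _ ≤ X ^ (3999 / 4000 : ℝ) * L ^ 2 := by
          refine mul_le_mul_of_nonneg_right ((Nat.floor_le hXJ0).trans hXJ.le) (by positivity)
  -- the main terms
  have hmainterm : |(X - X / 2 ^ J) * I * 𝔖 * (1 + corr) - X * 𝔖 * (1 + corr)| ≤
      12 * hφ * (X ^ (999 / 1000 : ℝ) + X ^ (3999 / 4000 : ℝ)) := by
    have e : (X - X / 2 ^ J) * I * 𝔖 * (1 + corr) - X * 𝔖 * (1 + corr) =
        -((X * (1 - I) + X / 2 ^ J * I) * (𝔖 * (1 + corr))) := by ring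
    rw [e, abs_neg, abs_mul, abs_mul]
    have h1 : |X * (1 - I) + X / 2 ^ J * I| ≤ X ^ (999 / 1000 : ℝ) + X ^ (3999 / 4000 : ℝ) := by
      have hI3 : 0 ≤ X * (1 - I) := mul_nonneg hX0.le (by linarith only [hI1])
      have hI4 : 0 ≤ X / 2 ^ J * I := mul_nonneg hXJ0 hI0
      rw [abs_of_nonneg (by linarith only [hI3, hI4])]
      have hI5 : X * (1 - I) ≤ 2 * δ * X := by
        have := mul_le_mul_of_nonneg_left (show 1 - I ≤ 2 * δ by linarith only [hI2]) hX0.le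
        linarith only [this]
      have hI6 : X / 2 ^ J * I ≤ X / 2 ^ J := mul_le_of_le_one_right hXJ0 hI1
      linarith only [hI5, hI6, hδX, hXJ]
    have h2 : |𝔖| * |1 + corr| ≤ 6 * hφ * 2 := by
      rw [abs_of_nonneg h𝔖0]
      exact mul_le_mul h𝔖le hcorr1 (abs_nonneg _) (by positivity)
    have h3 : 0 ≤ |𝔖| * |1 + corr| := by positivity
    calc |X * (1 - I) + X / 2 ^ J * I| * (|𝔖| * |1 + corr|)
        ≤ (X ^ (999 / 1000 : ℝ) + X ^ (3999 / 4000 : ℝ)) * (6 * hφ * 2) :=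
          mul_le_mul h1 h2 h3 (by positivity)
      _ = 12 * hφ * (X ^ (999 / 1000 : ℝ) + X ^ (3999 / 4000 : ℝ)) := by ring
  -- the polynomially small errors
  have hX99 : X ^ (999 / 1000 : ℝ) ≤ X ^ (3999 / 4000 : ℝ) := Real.rpow_le_rpow_of_exponent_le hX1 (by norm_num)
  have hX399_1 : 1 ≤ X ^ (3999 / 4000 : ℝ) := Real.one_le_rpow hX1 (by norm_num)
  have hL3 : L ^ 3 ≤ 24000 ^ 3 * (3 + A) * X ^ (1 / 8000 : ℝ) := by
    have h1 := log_pow_three_le_rpow (show (0 : ℝ) < 1 / 8000 by norm_num) (show (1 : ℝ) ≤ (3 + A) * X by linarith)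
    rw [← hL_def, Real.mul_rpow (by linarith) hX0.le] at h1
    have h2 : (3 + A) ^ (1 / 8000 : ℝ) ≤ 3 + A := by
      conv_rhs => rw [← Real.rpow_one (3 + A)]
      exact Real.rpow_le_rpow_of_exponent_le (by linarith) (by norm_num)
    have h3 : 0 ≤ X ^ (1 / 8000 : ℝ) := Real.rpow_nonneg hX0.le _
    calc L ^ 3 ≤ (3 / (1 / 8000)) ^ 3 * ((3 + A) ^ (1 / 8000 : ℝ) * X ^ (1 / 8000 : ℝ)) := h1
      _ = 24000 ^ 3 * ((3 + A) ^ (1 / 8000 : ℝ) * X ^ (1 / 8000 : ℝ)) := by norm_num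
      _ ≤ 24000 ^ 3 * ((3 + A) * X ^ (1 / 8000 : ℝ)) := by gcongr
      _ = 24000 ^ 3 * (3 + A) * X ^ (1 / 8000 : ℝ) := by ring
  have hstuff : X ^ (3999 / 4000 : ℝ) * L ^ 2 + (2 * δ * X + 2 * J) * L ^ 2 +
      12 * hφ * (X ^ (999 / 1000 : ℝ) + X ^ (3999 / 4000 : ℝ)) ≤ KA * hφ * X * X ^ (-(1 / 8000 : ℝ)) := by
    rw [hδX]
    have hpoly := poly_errors_le hX399_1 hX99 hL1 hhφ1 hJL
    have hX' : X ^ (3999 / 4000 : ℝ) * X ^ (1 / 8000 : ℝ) = X * X ^ (-(1 / 8000 : ℝ)) := by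
      rw [← Real.rpow_add hX0, show (3999 / 4000 : ℝ) + 1 / 8000 = 1 + -(1 / 8000) by norm_num,
        Real.rpow_add hX0, Real.rpow_one]
    have h4 : 30 * hφ * L ^ 3 * X ^ (3999 / 4000 : ℝ) ≤ KA * hφ * X * X ^ (-(1 / 8000 : ℝ)) := by
      have hφ0 : 0 ≤ hφ := by linarith only [hhφ1]
      calc 30 * hφ * L ^ 3 * X ^ (3999 / 4000 : ℝ)
          ≤ 30 * hφ * (24000 ^ 3 * (3 + A) * X ^ (1 / 8000 : ℝ)) * X ^ (3999 / 4000 : ℝ) :=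
            mul_le_mul_of_nonneg_right (mul_le_mul_of_nonneg_left hL3 (by positivity))
              (Real.rpow_nonneg hX0.le _)
        _ = KA * hφ * (X ^ (3999 / 4000 : ℝ) * X ^ (1 / 8000 : ℝ)) := by rw [hKA]; ring
        _ = KA * hφ * X * X ^ (-(1 / 8000 : ℝ)) := by rw [hX']; ring
    exact hpoly.trans h4
  have habsorb : KA * hφ * X * X ^ (-(1 / 8000 : ℝ)) ≤ KA * Kabs * hφ * X * E := by
    have h1 := Habs X hX3
    calc KA * hφ * X * X ^ (-(1 / 8000 : ℝ)) ≤ KA * hφ * X * (Kabs * Rc X) :=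
          mul_le_mul_of_nonneg_left h1 (by positivity)
      _ ≤ KA * hφ * X * (Kabs * E) := by gcongr
      _ = KA * Kabs * hφ * X * E := by ring
  -- assemble
  rw [sum_Icc_eq_sum_add_sum_dyadic a hX0.le J]
  have e : (∑ n ∈ Icc 1 ⌊X / 2 ^ J⌋₊, a n) +
      (∑ j ∈ Finset.range J, ∑ n ∈ Ioc ⌊X / 2 ^ (j + 1)⌋₊ ⌊X / 2 ^ j⌋₊, a n) - X * 𝔖 * (1 + corr) =
      (∑ n ∈ Icc 1 ⌊X / 2 ^ J⌋₊, a n) +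
      ((∑ j ∈ Finset.range J, ∑ n ∈ Ioc ⌊X / 2 ^ (j + 1)⌋₊ ⌊X / 2 ^ j⌋₊, a n) -
        (X - X / 2 ^ J) * I * 𝔖 * (1 + corr)) +
      ((X - X / 2 ^ J) * I * 𝔖 * (1 + corr) - X * 𝔖 * (1 + corr)) := by ring
  rw [e]
  calc |(∑ n ∈ Icc 1 ⌊X / 2 ^ J⌋₊, a n) +
        ((∑ j ∈ Finset.range J, ∑ n ∈ Ioc ⌊X / 2 ^ (j + 1)⌋₊ ⌊X / 2 ^ j⌋₊, a n) -
          (X - X / 2 ^ J) * I * 𝔖 * (1 + corr)) +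
        ((X - X / 2 ^ J) * I * 𝔖 * (1 + corr) - X * 𝔖 * (1 + corr))|
      ≤ |∑ n ∈ Icc 1 ⌊X / 2 ^ J⌋₊, a n| +
        |(∑ j ∈ Finset.range J, ∑ n ∈ Ioc ⌊X / 2 ^ (j + 1)⌋₊ ⌊X / 2 ^ j⌋₊, a n) -
          (X - X / 2 ^ J) * I * 𝔖 * (1 + corr)| +
        |(X - X / 2 ^ J) * I * 𝔖 * (1 + corr) - X * 𝔖 * (1 + corr)| := abs_add_three _ _ _
    _ ≤ X ^ (3999 / 4000 : ℝ) * L ^ 2 + ((2 * δ * X + 2 * J) * L ^ 2 + K' * hφ * X * E) +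
        12 * hφ * (X ^ (999 / 1000 : ℝ) + X ^ (3999 / 4000 : ℝ)) := add_le_add (add_le_add hinit hblocks) hmainterm
    _ ≤ K' * hφ * X * E + KA * Kabs * hφ * X * E := by linarith [hstuff, habsorb]
    _ = (K' + KA * Kabs) * ((h : ℝ) / (Nat.totient h : ℝ)) * X *
        (Real.exp (-C * Real.sqrt (V * Real.log η)) + Rc X +
          V * Real.log η ^ (6 : ℕ) / η) := by rw [hhφ, hE_def]; ring


set_option maxHeartbeats 800000 in
/-- **The degenerate regimes of Matomäki–Merikoski Theorem 1.3 (smoothed form) for a general second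
rate.** Fix `C`, `A > 0`, a rate `R ≥ 0` on `[3, ∞)` with `x^{−1/1000} ≤ K_e R(x)` (`x ≥ 3`), a
threshold `η₀` and `K₁ > 0`. If the smoothed dyadic bound with error
`K₁ (h/φ(h)) x (exp(−C√(V' log η)) + R(x) + V' log⁶η/η)` holds for EVEN `h`, `η ≥ η₀` and
`V' log⁶η/η ≤ 1` (`V' = log x/log q`; ranges `q ≥ 3`, `x ≥ q^{37/4}`,
`x^{−1/999}/4 ≤ δ ≤ min(x^{−1/1000}, 1/2)`, `1 ≤ h ≤ A x^{1+1/3999}`), then it holds, with another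
constant, for all `h ≥ 1` and `η ≥ 10`: for odd `h` the main term vanishes (`𝔖(h) = 0`) and the sum is
`≪_A log³ x ≤ K x R(x)`; if `η < η₀` or `V' log⁶η/η > 1` the error factor is `≥ min(1, 512/max(η₀,10))`
while sum and main term are both `≪_A (h/φ(h)) x` by the sieve bound `sum_vonMangoldt_mul_shift_le`
("[Theorem 1.3 follows] from Lemma 3.1(i) ... unless `η` is large", §7 of the source). The proof is
that of `smoothed_of_core` verbatim. [cite: MatomakiMerikoski2023, §7 first paragraph] -/
theorem smoothed_of_core_generic {C A : ℝ} (hA : 0 < A) {R : ℝ → ℝ}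
    (hR0 : ∀ x : ℝ, 3 ≤ x → 0 ≤ R x) {Ke : ℝ} (hKe : 0 < Ke)
    (He : ∀ x : ℝ, 3 ≤ x → x ^ (-(1 / 1000 : ℝ)) ≤ Ke * R x) {η₀ K₁ : ℝ} (hK₁ : 0 < K₁)
    (H₁ : ∀ (q : ℕ) [NeZero q], 3 ≤ q → ∀ χ : DirichletCharacter ℂ q, χ.IsPrimitive → χ.IsQuadratic →
        ∀ η : ℝ, 10 ≤ η → η₀ ≤ η → χ.LFunction ((1 - 1 / (η * Real.log q) : ℝ) : ℂ) = 0 →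
          ∀ x : ℝ, (q : ℝ) ^ (37 / 4 : ℝ) ≤ x → Real.log x / Real.log q * Real.log η ^ (6 : ℕ) / η ≤ 1 →
            ∀ δ : ℝ, x ^ (-(1 / 999 : ℝ)) / 4 ≤ δ → δ ≤ x ^ (-(1 / 1000 : ℝ)) → δ ≤ 1 / 2 →
            ∀ h : ℕ, 1 ≤ h → Even h → (h : ℝ) ≤ A * x ^ (1 + 1 / 3999 : ℝ) →
              |(∑ n ∈ Icc 1 ⌊2 * x⌋₊,
                  plateauCutoff (1 + δ) (2 - δ) δ (n / x) * (Λ n * Λ (n + h))) -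
                  x * (∫ u, plateauCutoff (1 + δ) (2 - δ) δ u) * goldbachSingularSeries h *
                    (1 + if Nat.totient (2 ^ padicValNat 2 q) ∣ h then
                          (-1 : ℝ) ^ (h / Nat.totient (2 ^ padicValNat 2 q)) *
                            ∏ p ∈ (q / 2 ^ padicValNat 2 q).primeFactors.filter (fun p => ¬ p ∣ h),
                              (-1 : ℝ) / ((p : ℝ) - 2)
                        else 0)| ≤
                K₁ * ((h : ℝ) / (Nat.totient h : ℝ)) * x *
                  (Real.exp (-C * Real.sqrt (Real.log x / Real.log q * Real.log η)) +
                    R x + Real.log x / Real.log q * Real.log η ^ (6 : ℕ) / η)) :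
    ∃ K : ℝ, 0 < K ∧
      ∀ (q : ℕ) [NeZero q], 3 ≤ q → ∀ χ : DirichletCharacter ℂ q, χ.IsPrimitive → χ.IsQuadratic →
        ∀ η : ℝ, 10 ≤ η → χ.LFunction ((1 - 1 / (η * Real.log q) : ℝ) : ℂ) = 0 →
          ∀ x : ℝ, (q : ℝ) ^ (37 / 4 : ℝ) ≤ x →
            ∀ δ : ℝ, x ^ (-(1 / 999 : ℝ)) / 4 ≤ δ → δ ≤ x ^ (-(1 / 1000 : ℝ)) → δ ≤ 1 / 2 →
            ∀ h : ℕ, 1 ≤ h → (h : ℝ) ≤ A * x ^ (1 + 1 / 3999 : ℝ) →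
              |(∑ n ∈ Icc 1 ⌊2 * x⌋₊,
                  plateauCutoff (1 + δ) (2 - δ) δ (n / x) * (Λ n * Λ (n + h))) -
                  x * (∫ u, plateauCutoff (1 + δ) (2 - δ) δ u) * goldbachSingularSeries h *
                    (1 + if Nat.totient (2 ^ padicValNat 2 q) ∣ h then
                          (-1 : ℝ) ^ (h / Nat.totient (2 ^ padicValNat 2 q)) *
                            ∏ p ∈ (q / 2 ^ padicValNat 2 q).primeFactors.filter (fun p => ¬ p ∣ h),
                              (-1 : ℝ) / ((p : ℝ) - 2)
                        else 0)| ≤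
                K * ((h : ℝ) / (Nat.totient h : ℝ)) * x *
                  (Real.exp (-C * Real.sqrt (Real.log x / Real.log q * Real.log η)) +
                    R x + Real.log x / Real.log q * Real.log η ^ (6 : ℕ) / η) := by
  obtain ⟨CB, hCB, HB⟩ := sum_vonMangoldt_mul_shift_le
  -- constants
  set η₁ : ℝ := max η₀ 10 with hη₁
  have hη₁0 : 0 < η₁ := lt_of_lt_of_le (by norm_num) (le_max_right _ _)
  set c₀ : ℝ := min 1 (512 / η₁) with hc₀
  have hc₀0 : 0 < c₀ := lt_min one_pos (by positivity)
  have hc₀1 : c₀ ≤ 1 := min_le_left _ _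
  set LA : ℝ := Real.log (2 + A) + 1.06 * Real.log A with hLA
  set aA : ℝ := Real.log (2 + A) + 1.01 with haA
  have haA1 : 1 ≤ aA := by
    have : 0 ≤ Real.log (2 + A) := Real.log_nonneg (by linarith)
    rw [haA]; linarith
  set KT : ℝ := (2 * CB + 2 * LA ^ 2 + 12) / c₀ with hKT
  have hKT0 : 0 < KT := by positivity
  set KO : ℝ := 8748 * aA ^ 2 * Ke with hKO
  have hKO0 : 0 < KO := by positivity
  refine ⟨K₁ + KT + KO, by positivity, ?_⟩
  intro q _ hq χ hprim hquad η hη hL x hx δ hδ hδup hδ2 h hh hhA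
  -- basic facts
  have hq2 : (3 : ℝ) ≤ q := by exact_mod_cast hq
  have hq8 : (256 : ℝ) ≤ (q : ℝ) ^ (37 / 4 : ℝ) := by
    have h9 : (3 : ℝ) ^ (9 : ℕ) = (3 : ℝ) ^ (9 : ℝ) := by exact_mod_cast (Real.rpow_natCast (3 : ℝ) 9).symm
    calc (256 : ℝ) ≤ (3 : ℝ) ^ (9 : ℕ) := by norm_num
      _ = (3 : ℝ) ^ (9 : ℝ) := h9
      _ ≤ (3 : ℝ) ^ (37 / 4 : ℝ) := Real.rpow_le_rpow_of_exponent_le (by norm_num) (by norm_num)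
      _ ≤ (q : ℝ) ^ (37 / 4 : ℝ) := Real.rpow_le_rpow (by norm_num) hq2 (by norm_num)
  have hx256 : (256 : ℝ) ≤ x := hq8.trans hx
  have hx1 : (1 : ℝ) ≤ x := by linarith
  have hx0 : 0 < x := by linarith
  have hlogq : 0 < Real.log q := Real.log_pos (by linarith)
  have hlogx : Real.log 256 ≤ Real.log x := Real.log_le_log (by norm_num) hx256
  have hlog256 : (5.5 : ℝ) ≤ Real.log 256 := by
    rw [show (256 : ℝ) = 2 ^ 8 by norm_num, Real.log_pow]
    have := Real.log_two_gt_d9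
    push_cast; linarith only [this]
  have hlogx5 : (5.5 : ℝ) ≤ Real.log x := hlog256.trans hlogx
  have hlogx0 : 0 < Real.log x := by linarith
  have hη0 : 0 < η := by linarith
  have hlogη : 2 ≤ Real.log η := by
    have hlog10 : (2 : ℝ) < Real.log 10 := by
      rw [Real.lt_log_iff_exp_lt (by norm_num)]
      have h1 : Real.exp 1 < 2.7182818286 := Real.exp_one_lt_d9
      have h2 : Real.exp 2 = Real.exp 1 * Real.exp 1 := by rw [← Real.exp_add]; norm_num
      rw [h2]; nlinarith [Real.exp_pos 1]
    have := Real.log_le_log (by norm_num) hη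
    linarith
  have hlogη6 : (64 : ℝ) ≤ Real.log η ^ (6 : ℕ) := by
    have := pow_le_pow_left₀ (by norm_num : (0 : ℝ) ≤ 2) hlogη 6
    norm_num at this; linarith
  have hV0 : 0 ≤ Real.log x / Real.log q := div_nonneg hlogx0.le hlogq.le
  have hterm0 : 0 ≤ Real.log x / Real.log q * Real.log η ^ (6 : ℕ) / η :=
    div_nonneg (mul_nonneg hV0 (pow_nonneg (by linarith) 6)) hη0.le
  have hV' : 8 ≤ Real.log x / Real.log q := by
    rw [le_div_iff₀ hlogq]
    have : Real.log ((q : ℝ) ^ (37 / 4 : ℝ)) ≤ Real.log x := Real.log_le_log (by positivity) hx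
    rw [Real.log_rpow (by linarith)] at this
    nlinarith only [this, hlogq]
  -- the error factor
  set E : ℝ := Real.exp (-C * Real.sqrt (Real.log x / Real.log q * Real.log η)) + R x +
      Real.log x / Real.log q * Real.log η ^ (6 : ℕ) / η with hE
  have hRx : 0 ≤ R x := hR0 x (by linarith)
  have hE3 : Real.log x / Real.log q * Real.log η ^ (6 : ℕ) / η ≤ E := by
    rw [hE]; linarith [Real.exp_pos (-C * Real.sqrt (Real.log x / Real.log q * Real.log η)), hRx]
  have hE2 : R x ≤ E := by
    rw [hE]
    linarith only [Real.exp_pos (-C * Real.sqrt (Real.log x / Real.log q * Real.log η)), hterm0]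
  have hE1 : Real.exp (-C * Real.sqrt (Real.log x / Real.log q * Real.log η)) ≤ E := by
    rw [hE]; linarith only [hRx, hterm0]
  have hE0 : 0 < E := lt_of_lt_of_le (Real.exp_pos _) hE1
  have hEη : 512 / η ≤ E := by
    refine le_trans ?_ hE3
    have h1 : (512 : ℝ) ≤ Real.log x / Real.log q * Real.log η ^ (6 : ℕ) := by
      calc (512 : ℝ) = 8 * 64 := by norm_num
        _ ≤ Real.log x / Real.log q * Real.log η ^ (6 : ℕ) :=
            mul_le_mul hV' hlogη6 (by norm_num) hV0
    exact div_le_div_of_nonneg_right h1 hη0.le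
  -- the weight, the harmless factors
  have hδ0 : 0 < δ := by
    have : 0 < x ^ (-(1 / 999 : ℝ)) / 4 := by positivity
    linarith
  set g : ℝ → ℝ := plateauCutoff (1 + δ) (2 - δ) δ with hg
  obtain ⟨hI0, hI1⟩ := integral_plateauCutoff_mem hδ0 hδ2
  set corr : ℝ := (if Nat.totient (2 ^ padicValNat 2 q) ∣ h then
      (-1 : ℝ) ^ (h / Nat.totient (2 ^ padicValNat 2 q)) *
        ∏ p ∈ (q / 2 ^ padicValNat 2 q).primeFactors.filter (fun p => ¬ p ∣ h),
          (-1 : ℝ) / ((p : ℝ) - 2)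
      else 0) with hcorr_def
  have hcorr1 : |1 + corr| ≤ 2 := by
    have h1 := abs_corr_le_one q h
    have := abs_add_le (1 : ℝ) corr; rw [abs_one] at this; linarith
  set w : ℝ := (h : ℝ) / (Nat.totient h : ℝ) with hw
  have hh0 : h ≠ 0 := by omega
  have hφ0 : (0 : ℝ) < Nat.totient h := by exact_mod_cast Nat.totient_pos.mpr (by omega)
  have hw1 : 1 ≤ w := by rw [hw, le_div_iff₀ hφ0, one_mul]; exact_mod_cast Nat.totient_le h
  have hS6 : goldbachSingularSeries h ≤ 6 * w := goldbachSingularSeries_le_mul_div_totient hh0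
  have hS0 : 0 ≤ goldbachSingularSeries h :=
    Literature.NumberTheory.Sieve.SingularSeriesMean.goldbachSingularSeries_nonneg h
  -- the main term is `≤ 12 w x` in modulus
  have hmain : |x * (∫ u, g u) * goldbachSingularSeries h * (1 + corr)| ≤ 12 * w * x := by
    rw [abs_mul, abs_mul, abs_mul, abs_of_pos hx0, abs_of_nonneg hI0, abs_of_nonneg hS0]
    calc x * (∫ u, g u) * goldbachSingularSeries h * |1 + corr|
        ≤ x * 1 * (6 * w) * 2 := by gcongr
      _ = 12 * w * x := by ring
  -- the integer range
  set N : ℕ := ⌊2 * x⌋₊ with hN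
  have hN2x : (N : ℝ) ≤ 2 * x := Nat.floor_le (by linarith)
  have hxN : x ≤ N := by
    have := Nat.lt_floor_add_one (2 * x); rw [← hN] at this; linarith
  have hN2 : 2 ≤ N := by
    rw [hN]; exact Nat.le_floor (by push_cast; linarith)
  have hN0 : (0 : ℝ) < N := by exact_mod_cast (show 0 < N by omega)
  have hsmooth := abs_sum_smooth_le (x := x) hδ0 hδ2 h
  -- `N + h ≤ (2 + A) x^{1.01}`
  have hx101 : x ≤ x ^ (1 + 1 / 3999 : ℝ) := by
    calc x = x ^ (1 : ℝ) := (Real.rpow_one x).symm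
      _ ≤ x ^ (1 + 1 / 3999 : ℝ) := Real.rpow_le_rpow_of_exponent_le hx1 (by norm_num)
  have hNh : (N : ℝ) + h ≤ (2 + A) * x ^ (1 + 1 / 3999 : ℝ) := by
    have : (2 + A) * x ^ (1 + 1 / 3999 : ℝ) = 2 * x ^ (1 + 1 / 3999 : ℝ) + A * x ^ (1 + 1 / 3999 : ℝ) := by
      ring
    rw [this]; linarith only [hN2x, hx101, hhA]
  have hlogNh : Real.log ((N : ℝ) + h) ≤ Real.log (2 + A) + 1.01 * Real.log x := by
    have h0 : (0 : ℝ) < (N : ℝ) + h := by positivity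
    calc Real.log ((N : ℝ) + h) ≤ Real.log ((2 + A) * x ^ (1 + 1 / 3999 : ℝ)) := Real.log_le_log h0 hNh
      _ = Real.log (2 + A) + (1 + 1 / 3999) * Real.log x := by
          rw [Real.log_mul (by positivity) (by positivity), Real.log_rpow hx0]
      _ ≤ Real.log (2 + A) + 1.01 * Real.log x := by nlinarith only [hlogx0]
  have hlogNh' : Real.log ((N : ℝ) + h) ≤ aA * Real.log x := by
    have h2A : 0 ≤ Real.log (2 + A) := Real.log_nonneg (by linarith)
    have hm : 0 ≤ Real.log (2 + A) * (Real.log x - 1) := mul_nonneg h2A (by linarith only [hlogx5])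
    calc Real.log ((N : ℝ) + h) ≤ Real.log (2 + A) + 1.01 * Real.log x := hlogNh
      _ ≤ Real.log (2 + A) * Real.log x + 1.01 * Real.log x := by linarith only [hm]
      _ = aA * Real.log x := by rw [haA]; ring
  have hlogNh0 : 0 ≤ Real.log ((N : ℝ) + h) := Real.log_nonneg (by
    have : (2 : ℝ) ≤ N := by exact_mod_cast hN2
    have : (0 : ℝ) ≤ h := Nat.cast_nonneg h
    linarith)
  ------------------------------------------------------------------
  -- Regime T: the error factor is `≥ c₀`
  ------------------------------------------------------------------
  by_cases hT : c₀ ≤ E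
  · have hsumle : ∑ n ∈ Icc 1 N, Λ n * Λ (n + h) ≤ (2 * CB + 2 * LA ^ 2) * w * x := by
      by_cases hAx : A ≤ x ^ (3998 / 3999 : ℝ)
      · -- sieve bound: `h ≤ A x^{1+1/3999} ≤ x^{1−1/3999} x^{1+1/3999} = x² ≤ N²`
        have hhN2 : (h : ℝ) ≤ (N : ℝ) ^ 2 := by
          calc (h : ℝ) ≤ A * x ^ (1 + 1 / 3999 : ℝ) := hhA
            _ ≤ x ^ (3998 / 3999 : ℝ) * x ^ (1 + 1 / 3999 : ℝ) :=
                mul_le_mul_of_nonneg_right hAx (by positivity)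
            _ = x ^ 2 := by
                rw [← Real.rpow_add hx0, ← Real.rpow_natCast]; norm_num
            _ ≤ (N : ℝ) ^ 2 := pow_le_pow_left₀ hx0.le hxN 2
        have hhN2' : h ≤ N ^ 2 := by exact_mod_cast hhN2
        calc ∑ n ∈ Icc 1 N, Λ n * Λ (n + h) ≤ CB * ((h : ℝ) / Nat.totient h) * N := HB N h hN2 hh hhN2'
          _ ≤ CB * w * (2 * x) := by rw [← hw]; gcongr
          _ = 2 * CB * w * x := by ring
          _ ≤ (2 * CB + 2 * LA ^ 2) * w * x := by
              have : 0 ≤ 2 * LA ^ 2 * w * x := by positivity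
              linarith
      · -- `x^{1−1/3999} < A`: everything is bounded in terms of `A`
        push Not at hAx
        have hx99 : (1 : ℝ) ≤ x ^ (3998 / 3999 : ℝ) := Real.one_le_rpow hx1 (by norm_num)
        have hA1 : 1 < A := lt_of_le_of_lt hx99 hAx
        have hlogA : 3998 / 3999 * Real.log x < Real.log A := by
          have := Real.log_lt_log (by positivity) hAx
          rwa [Real.log_rpow hx0] at this
        have hlApos : 0 < Real.log A := Real.log_pos hA1
        have hlogxA : Real.log x ≤ 1.04 * Real.log A := by linarith only [hlogA, hlApos.le]
        have hLA' : Real.log ((N : ℝ) + h) ≤ LA := by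
          calc Real.log ((N : ℝ) + h) ≤ Real.log (2 + A) + 1.01 * Real.log x := hlogNh
            _ ≤ Real.log (2 + A) + 1.06 * Real.log A := by linarith only [hlogxA, hlApos.le]
            _ = LA := by rw [hLA]
        have hLA0 : 0 ≤ LA := hlogNh0.trans hLA'
        calc ∑ n ∈ Icc 1 N, Λ n * Λ (n + h) ≤ N * Real.log ((N : ℝ) + h) ^ 2 :=
              sum_vonMangoldt_mul_le_card_mul_log_sq N h
          _ ≤ (2 * x) * LA ^ 2 := by
              gcongr
          _ ≤ (2 * x) * LA ^ 2 * w := le_mul_of_one_le_right (by positivity) hw1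
          _ = 2 * LA ^ 2 * w * x := by ring
          _ ≤ (2 * CB + 2 * LA ^ 2) * w * x := by
              have : 0 ≤ 2 * CB * w * x := by positivity
              linarith
    have hKTc : (2 * CB + 2 * LA ^ 2 + 12) = KT * c₀ := by
      rw [hKT]; field_simp
    calc |(∑ n ∈ Icc 1 N, g (n / x) * (Λ n * Λ (n + h))) -
            x * (∫ u, g u) * goldbachSingularSeries h * (1 + corr)|
        ≤ |∑ n ∈ Icc 1 N, g (n / x) * (Λ n * Λ (n + h))| +
            |x * (∫ u, g u) * goldbachSingularSeries h * (1 + corr)| := abs_sub _ _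
      _ ≤ (2 * CB + 2 * LA ^ 2) * w * x + 12 * w * x := add_le_add (hsmooth.trans hsumle) hmain
      _ = KT * c₀ * w * x := by rw [← hKTc]; ring
      _ ≤ KT * E * w * x := by gcongr
      _ ≤ (K₁ + KT + KO) * w * x * E := by
          have h0 : 0 ≤ (K₁ + KO) * w * x * E := by positivity
          have e : (K₁ + KT + KO) * w * x * E = KT * E * w * x + (K₁ + KO) * w * x * E := by ring
          rw [e]; linarith only [h0]
  push Not at hT
  ------------------------------------------------------------------
  -- Regime O: odd `h`
  ------------------------------------------------------------------
  by_cases hodd : Odd h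
  · have hmain0 : x * (∫ u, g u) * goldbachSingularSeries h * (1 + corr) = 0 := by
      rw [goldbachSingularSeries_of_odd hodd]; ring
    -- `∑ ≤ 12 aA² log³ x`
    have hl2 : (0.6931471803 : ℝ) < Real.log 2 := Real.log_two_gt_d9
    have hNat : (Nat.log 2 (N + h) : ℝ) ≤ Real.log ((N : ℝ) + h) / Real.log 2 := by
      rw [le_div_iff₀ (by linarith), ← Real.log_pow]
      have : ((2 ^ Nat.log 2 (N + h) : ℕ) : ℝ) ≤ (N : ℝ) + h := by
        exact_mod_cast Nat.pow_log_le_self 2 (by omega)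
      push_cast at this
      exact Real.log_le_log (by positivity) this
    have hlogN : Real.log N ≤ 2 * Real.log x := by
      calc Real.log N ≤ Real.log (2 * x) := Real.log_le_log hN0 hN2x
        _ = Real.log 2 + Real.log x := Real.log_mul (by norm_num) hx0.ne'
        _ ≤ 2 * Real.log x := by
            have : Real.log 2 < 0.6931471808 := Real.log_two_lt_d9
            linarith
    have hlogN0 : 0 ≤ Real.log N := Real.log_nonneg (by exact_mod_cast (show 1 ≤ N by omega))
    have hodd_sum : ∑ n ∈ Icc 1 N, Λ n * Λ (n + h) ≤ 12 * aA ^ 2 * Real.log x ^ 3 := by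
      have h1 := sum_vonMangoldt_mul_shift_le_of_odd (N := N) hodd
      have hfac1 : 2 * ((Nat.log 2 (N + h) : ℝ) + 1) ≤ 6 * (aA * Real.log x) := by
        have h3 : (Nat.log 2 (N + h) : ℝ) ≤ 2 * (aA * Real.log x) := by
          calc (Nat.log 2 (N + h) : ℝ) ≤ Real.log ((N : ℝ) + h) / Real.log 2 := hNat
            _ ≤ (aA * Real.log x) / Real.log 2 := by gcongr
            _ ≤ 2 * (aA * Real.log x) := by
                rw [div_le_iff₀ (by linarith only [hl2])]
                have hpos : 0 ≤ aA * Real.log x := by positivity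
                have h22 : (1 : ℝ) ≤ 2 * Real.log 2 := by linarith only [hl2]
                nlinarith only [hpos, h22]
        have h4 : (1 : ℝ) ≤ aA * Real.log x :=
          one_le_mul_of_one_le_of_one_le haA1 (by linarith only [hlogx5])
        linarith only [h3, h4]
      calc ∑ n ∈ Icc 1 N, Λ n * Λ (n + h)
          ≤ 2 * ((Nat.log 2 (N + h) : ℝ) + 1) * (Real.log N * Real.log ((N : ℝ) + h)) := h1
        _ ≤ 6 * (aA * Real.log x) * (2 * Real.log x * (aA * Real.log x)) := by
            gcongr
        _ = 12 * aA ^ 2 * Real.log x ^ 3 := by ring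
    -- `log³ x ≤ 729 x^{1/3} ≤ 729 x · x^{-1/1000} ≤ 729 Ke x R(x)`
    have hL9 : Real.log x ≤ 9 * x ^ ((1 : ℝ) / 9) :=
      Literature.NumberTheory.Sieve.PrimePairsVonMangoldt.log_le_nine_mul_rpow hx0.le
    have hL3 : Real.log x ^ 3 ≤ 729 * (x * x ^ (-(1 / 1000 : ℝ))) := by
      calc Real.log x ^ 3 ≤ (9 * x ^ ((1 : ℝ) / 9)) ^ 3 := pow_le_pow_left₀ hlogx0.le hL9 3
        _ = 729 * x ^ ((1 : ℝ) / 3) := by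
            rw [mul_pow, ← Real.rpow_natCast (x ^ ((1 : ℝ) / 9)), ← Real.rpow_mul hx0.le]
            norm_num
        _ ≤ 729 * (x * x ^ (-(1 / 1000 : ℝ))) := by
            gcongr
            rw [show x * x ^ (-(1 / 1000 : ℝ)) = x ^ ((1 : ℝ) + -(1 / 1000 : ℝ)) by
              rw [Real.rpow_add hx0, Real.rpow_one]]
            exact Real.rpow_le_rpow_of_exponent_le hx1 (by norm_num)
    have hHe := He x (by linarith)
    calc |(∑ n ∈ Icc 1 N, g (n / x) * (Λ n * Λ (n + h))) -
            x * (∫ u, g u) * goldbachSingularSeries h * (1 + corr)|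
        = |∑ n ∈ Icc 1 N, g (n / x) * (Λ n * Λ (n + h))| := by rw [hmain0, sub_zero]
      _ ≤ 12 * aA ^ 2 * Real.log x ^ 3 := hsmooth.trans hodd_sum
      _ ≤ 12 * aA ^ 2 * (729 * (x * x ^ (-(1 / 1000 : ℝ)))) := by gcongr
      _ ≤ 12 * aA ^ 2 * (729 * (x * (Ke * R x))) := by gcongr
      _ = KO * x * R x := by rw [hKO]; ring
      _ ≤ KO * x * E := by gcongr
      _ ≤ (K₁ + KT + KO) * w * x * E := by
          have h1 : KO * x * E ≤ KO * x * E * w := le_mul_of_one_le_right (by positivity) hw1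
          have h2 : 0 ≤ (K₁ + KT) * w * x * E := by positivity
          have e : (K₁ + KT + KO) * w * x * E = KO * x * E * w + (K₁ + KT) * w * x * E := by ring
          rw [e]; linarith only [h1, h2]
  ------------------------------------------------------------------
  -- Core regime: `h` even, `η ≥ η₁ ≥ η₀`, normalised error
  ------------------------------------------------------------------
  have heven : Even h := Nat.not_odd_iff_even.mp hodd
  have hη₁η : η₁ ≤ η := by
    by_contra hlt
    push Not at hlt
    have : 512 / η₁ ≤ E := by
      calc 512 / η₁ ≤ 512 / η := div_le_div_of_nonneg_left (by norm_num) hη0 hlt.le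
        _ ≤ E := hEη
    exact absurd ((min_le_right _ _).trans this) (not_le.mpr hT)
  have hη₀η : η₀ ≤ η := (le_max_left _ _).trans hη₁η
  have hnorm : Real.log x / Real.log q * Real.log η ^ (6 : ℕ) / η ≤ 1 :=
    (hE3.trans hT.le).trans hc₀1
  have hcore := H₁ q hq χ hprim hquad η hη hη₀η hL x hx hnorm δ hδ hδup hδ2 h hh heven hhA
  calc |(∑ n ∈ Icc 1 N, g (n / x) * (Λ n * Λ (n + h))) -
          x * (∫ u, g u) * goldbachSingularSeries h * (1 + corr)|
      ≤ K₁ * w * x * E := hcore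
    _ ≤ (K₁ + KT + KO) * w * x * E := by
        have h0 : 0 ≤ (KT + KO) * w * x * E := by positivity
        have e : (K₁ + KT + KO) * w * x * E = K₁ * w * x * E + (KT + KO) * w * x * E := by ring
        rw [e]; linarith only [h0]


end MMSmoothing

open MMSmoothing

/-- **Matomäki–Merikoski 2023, Theorem 1.3 in the CLASSICAL shape from its smoothed dyadic form with the
classical second rate.** If for every `C ≥ 1`, `A > 0` there is `K` such that the smoothed dyadic bound of
§2 holds (ranges as in `MatomakiMerikoski2023_pairCorrelation_of_smoothed'`: `q ≥ 3`, `x ≥ q^{37/4}`,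
`x^{−1/999}/4 ≤ δ ≤ min(x^{−1/1000}, 1/2)`, `1 ≤ h ≤ A x^{1+1/3999}`) with the error
`K (h/φ(h)) x (exp(−C√(V' log η)) + exp(−c₀ √log x) + V' log⁶η/η)` for a fixed `c₀ > 0` — the output
of §§5–7 of the source when Lemma 2.4 is used with the classical zero-free region
(`MatomakiMerikoski2023_lemma24_classical`) — then Theorem 1.3 holds for positive shifts `h ≤ AX`,
`X = q^V`, `V ≥ 10`, every `C ≥ 1`, with the second rate `exp(−(c₀/2) √log X)`: the hypothesis `h13` of
`MatomakiMerikoski2023_fixedShift_of_pairCorrelation_classical` and of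
`MatomakiMerikoski2023_fixedShift_ii_of_pairCorrelation_classical` at the constant `c₀/2`. Instance
`R_h(x) = exp(−c₀√log x)`, `R_c(X) = exp(−(c₀/2)√log X)` of `MMSmoothing.pairCorrelation_of_smoothed_generic`
(`√log x ≥ √(0.89 log X) ≥ ½ √log X`; `X^{−1/8000} ≪ exp(−(c₀/2)√log X)` by
`MMSmoothing.exists_rpow_neg_le_mul_exp_sqrt`). [cite: MatomakiMerikoski2023, §2 and Theorem 1.3] -/
theorem MatomakiMerikoski2023_pairCorrelation_classical_of_smoothed' {c₀ : ℝ} (hc₀ : 0 < c₀)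
    (H : ∀ C : ℝ, 1 ≤ C → ∀ A : ℝ, 0 < A → ∃ K : ℝ, 0 < K ∧
      ∀ (q : ℕ) [NeZero q], 3 ≤ q → ∀ χ : DirichletCharacter ℂ q, χ.IsPrimitive → χ.IsQuadratic →
        ∀ η : ℝ, 10 ≤ η → χ.LFunction ((1 - 1 / (η * Real.log q) : ℝ) : ℂ) = 0 →
          ∀ x : ℝ, (q : ℝ) ^ (37 / 4 : ℝ) ≤ x →
            ∀ δ : ℝ, x ^ (-(1 / 999 : ℝ)) / 4 ≤ δ → δ ≤ x ^ (-(1 / 1000 : ℝ)) → δ ≤ 1 / 2 →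
            ∀ h : ℕ, 1 ≤ h → (h : ℝ) ≤ A * x ^ (1 + 1 / 3999 : ℝ) →
              |(∑ n ∈ Icc 1 ⌊2 * x⌋₊,
                  plateauCutoff (1 + δ) (2 - δ) δ (n / x) * (Λ n * Λ (n + h))) -
                  x * (∫ u, plateauCutoff (1 + δ) (2 - δ) δ u) * goldbachSingularSeries h *
                    (1 + if Nat.totient (2 ^ padicValNat 2 q) ∣ h then
                          (-1 : ℝ) ^ (h / Nat.totient (2 ^ padicValNat 2 q)) *
                            ∏ p ∈ (q / 2 ^ padicValNat 2 q).primeFactors.filter (fun p => ¬ p ∣ h),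
                              (-1 : ℝ) / ((p : ℝ) - 2)
                        else 0)| ≤
                K * ((h : ℝ) / (Nat.totient h : ℝ)) * x *
                  (Real.exp (-C * Real.sqrt (Real.log x / Real.log q * Real.log η)) +
                    Real.exp (-c₀ * Real.sqrt (Real.log x)) +
                    Real.log x / Real.log q * Real.log η ^ (6 : ℕ) / η)) :
    ∀ C : ℝ, 1 ≤ C → ∀ A : ℝ, 0 < A → ∃ K : ℝ, 0 < K ∧
      ∀ (q : ℕ) [NeZero q], 2 ≤ q → ∀ χ : DirichletCharacter ℂ q, χ.IsPrimitive → χ.IsQuadratic →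
        ∀ η : ℝ, 10 ≤ η → χ.LFunction ((1 - 1 / (η * Real.log q) : ℝ) : ℂ) = 0 →
          ∀ V X : ℝ, 10 ≤ V → X = (q : ℝ) ^ V → ∀ h : ℕ, 1 ≤ h → (h : ℝ) ≤ A * X →
            |(∑ n ∈ Icc 1 ⌊X⌋₊, Λ n * Λ (n + h)) -
                X * goldbachSingularSeries h *
                  (1 + if Nat.totient (2 ^ padicValNat 2 q) ∣ h then
                        (-1 : ℝ) ^ (h / Nat.totient (2 ^ padicValNat 2 q)) *
                          ∏ p ∈ (q / 2 ^ padicValNat 2 q).primeFactors.filter (fun p => ¬ p ∣ h),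
                            (-1 : ℝ) / ((p : ℝ) - 2)
                      else 0)| ≤
              K * ((h : ℝ) / (Nat.totient h : ℝ)) * X *
                (Real.exp (-C * Real.sqrt (V * Real.log η)) +
                  Real.exp (-(c₀ / 2) * Real.sqrt (Real.log X)) +
                  V * Real.log η ^ (6 : ℕ) / η) := by
  intro C hC A hA
  obtain ⟨K', hK', H'⟩ := H (2 * C) (by linarith) (3 * A) (by positivity)
  obtain ⟨Kabs, hKabs, Habs⟩ := exists_rpow_neg_le_mul_exp_sqrt (show (0 : ℝ) < 1 / 8000 by norm_num) (c₀ / 2)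
  refine ⟨K' + 30 * 24000 ^ 3 * (3 + A) * Kabs, by positivity, ?_⟩
  have hR : ∀ x X : ℝ, 1024 ≤ X → 0.89 * Real.log X ≤ Real.log x → Real.log x ≤ Real.log X →
      Real.exp (-c₀ * Real.sqrt (Real.log x)) ≤ Real.exp (-(c₀ / 2) * Real.sqrt (Real.log X)) := by
    intro x X hX hlow _hup
    have hlogX : 0 ≤ Real.log X := Real.log_nonneg (by linarith)
    refine Real.exp_le_exp.mpr ?_
    -- `½ √log X ≤ √log x` since `log X ≤ 4 log x`
    have hsq : Real.sqrt (Real.log X) ≤ 2 * Real.sqrt (Real.log x) := by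
      rw [show (2 : ℝ) = Real.sqrt 4 by rw [show (4 : ℝ) = 2 ^ 2 by norm_num, Real.sqrt_sq (by norm_num)],
        ← Real.sqrt_mul (by norm_num)]
      exact Real.sqrt_le_sqrt (by linarith)
    nlinarith [Real.sqrt_nonneg (Real.log x), hc₀]
  have hA3 : ∀ (x : ℝ) (h : ℕ), (h : ℝ) ≤ 3 * A * x ^ (1 + 1 / 3999 : ℝ) →
      (h : ℝ) ≤ (3 * A) * x ^ (1 + 1 / 3999 : ℝ) := fun x h hh => hh
  exact pairCorrelation_of_smoothed_generic (Rh := fun x => Real.exp (-c₀ * Real.sqrt (Real.log x)))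
    (Rc := fun X => Real.exp (-(c₀ / 2) * Real.sqrt (Real.log X)))
    (by linarith : (0 : ℝ) ≤ C) hA hK' hKabs (fun X _ => (Real.exp_pos _).le) hR Habs
    (fun q _ hq χ hprim hquad η hη hL x hx δ hδ1 hδ2 hδ3 h hh hhx =>
      H' q hq χ hprim hquad η hη hL x hx δ hδ1 hδ2 hδ3 h hh (hA3 x h hhx))

/-- **Corollary 1.1(i) from the classical smoothed dyadic form of Theorem 1.3**: compose
`MatomakiMerikoski2023_pairCorrelation_classical_of_smoothed'` (constant `c₀/2`) with
`MatomakiMerikoski2023_fixedShift_of_pairCorrelation_classical` (`SiegelZeroPrimePairsFixedShift.lean`).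
[cite: MatomakiMerikoski2023, Corollary 1.1(i), §2 and the deduction after Theorem 1.4] -/
theorem MatomakiMerikoski2023_fixedShift_of_smoothed_classical {c₀ : ℝ} (hc₀ : 0 < c₀)
    (H : ∀ C : ℝ, 1 ≤ C → ∀ A : ℝ, 0 < A → ∃ K : ℝ, 0 < K ∧
      ∀ (q : ℕ) [NeZero q], 3 ≤ q → ∀ χ : DirichletCharacter ℂ q, χ.IsPrimitive → χ.IsQuadratic →
        ∀ η : ℝ, 10 ≤ η → χ.LFunction ((1 - 1 / (η * Real.log q) : ℝ) : ℂ) = 0 →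
          ∀ x : ℝ, (q : ℝ) ^ (37 / 4 : ℝ) ≤ x →
            ∀ δ : ℝ, x ^ (-(1 / 999 : ℝ)) / 4 ≤ δ → δ ≤ x ^ (-(1 / 1000 : ℝ)) → δ ≤ 1 / 2 →
            ∀ h : ℕ, 1 ≤ h → (h : ℝ) ≤ A * x ^ (1 + 1 / 3999 : ℝ) →
              |(∑ n ∈ Icc 1 ⌊2 * x⌋₊,
                  plateauCutoff (1 + δ) (2 - δ) δ (n / x) * (Λ n * Λ (n + h))) -
                  x * (∫ u, plateauCutoff (1 + δ) (2 - δ) δ u) * goldbachSingularSeries h *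
                    (1 + if Nat.totient (2 ^ padicValNat 2 q) ∣ h then
                          (-1 : ℝ) ^ (h / Nat.totient (2 ^ padicValNat 2 q)) *
                            ∏ p ∈ (q / 2 ^ padicValNat 2 q).primeFactors.filter (fun p => ¬ p ∣ h),
                              (-1 : ℝ) / ((p : ℝ) - 2)
                        else 0)| ≤
                K * ((h : ℝ) / (Nat.totient h : ℝ)) * x *
                  (Real.exp (-C * Real.sqrt (Real.log x / Real.log q * Real.log η)) +
                    Real.exp (-c₀ * Real.sqrt (Real.log x)) +
                    Real.log x / Real.log q * Real.log η ^ (6 : ℕ) / η)) :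
    MatomakiMerikoski2023_fixedShift :=
  MatomakiMerikoski2023_fixedShift_of_pairCorrelation_classical (half_pos hc₀)
    (MatomakiMerikoski2023_pairCorrelation_classical_of_smoothed' hc₀ H)

/-- **The classical smoothed dyadic form of Theorem 1.3 from its core regime.** The classical instance
`R(x) = exp(−c₀ √log x)` of `MMSmoothing.smoothed_of_core_generic` (`x^{−1/1000} ≪ exp(−c₀ √log x)`,
`MMSmoothing.exists_rpow_neg_le_mul_exp_sqrt`), in the quantifier shape of
`MatomakiMerikoski2023_pairCorrelation_classical_of_smoothed'`: if for every `C ≥ 1`, `A > 0` there are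
`η₀`, `K` with the smoothed dyadic bound (second rate `exp(−c₀ √log x)`) for even `h`, `η ≥ η₀`,
`V' log⁶η/η ≤ 1`, then the bound holds for all `h ≥ 1`, `η ≥ 10`.
[cite: MatomakiMerikoski2023, §7 first paragraph] -/
theorem MatomakiMerikoski2023_smoothed_classical_of_core {c₀ : ℝ}
    (Hcore : ∀ C : ℝ, 1 ≤ C → ∀ A : ℝ, 0 < A → ∃ η₀ K : ℝ, 0 < K ∧
      ∀ (q : ℕ) [NeZero q], 3 ≤ q → ∀ χ : DirichletCharacter ℂ q, χ.IsPrimitive → χ.IsQuadratic →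
        ∀ η : ℝ, 10 ≤ η → η₀ ≤ η → χ.LFunction ((1 - 1 / (η * Real.log q) : ℝ) : ℂ) = 0 →
          ∀ x : ℝ, (q : ℝ) ^ (37 / 4 : ℝ) ≤ x → Real.log x / Real.log q * Real.log η ^ (6 : ℕ) / η ≤ 1 →
            ∀ δ : ℝ, x ^ (-(1 / 999 : ℝ)) / 4 ≤ δ → δ ≤ x ^ (-(1 / 1000 : ℝ)) → δ ≤ 1 / 2 →
            ∀ h : ℕ, 1 ≤ h → Even h → (h : ℝ) ≤ A * x ^ (1 + 1 / 3999 : ℝ) →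
              |(∑ n ∈ Icc 1 ⌊2 * x⌋₊,
                  plateauCutoff (1 + δ) (2 - δ) δ (n / x) * (Λ n * Λ (n + h))) -
                  x * (∫ u, plateauCutoff (1 + δ) (2 - δ) δ u) * goldbachSingularSeries h *
                    (1 + if Nat.totient (2 ^ padicValNat 2 q) ∣ h then
                          (-1 : ℝ) ^ (h / Nat.totient (2 ^ padicValNat 2 q)) *
                            ∏ p ∈ (q / 2 ^ padicValNat 2 q).primeFactors.filter (fun p => ¬ p ∣ h),
                              (-1 : ℝ) / ((p : ℝ) - 2)
                        else 0)| ≤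
                K * ((h : ℝ) / (Nat.totient h : ℝ)) * x *
                  (Real.exp (-C * Real.sqrt (Real.log x / Real.log q * Real.log η)) +
                    Real.exp (-c₀ * Real.sqrt (Real.log x)) +
                    Real.log x / Real.log q * Real.log η ^ (6 : ℕ) / η)) :
    ∀ C : ℝ, 1 ≤ C → ∀ A : ℝ, 0 < A → ∃ K : ℝ, 0 < K ∧
      ∀ (q : ℕ) [NeZero q], 3 ≤ q → ∀ χ : DirichletCharacter ℂ q, χ.IsPrimitive → χ.IsQuadratic →
        ∀ η : ℝ, 10 ≤ η → χ.LFunction ((1 - 1 / (η * Real.log q) : ℝ) : ℂ) = 0 →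
          ∀ x : ℝ, (q : ℝ) ^ (37 / 4 : ℝ) ≤ x →
            ∀ δ : ℝ, x ^ (-(1 / 999 : ℝ)) / 4 ≤ δ → δ ≤ x ^ (-(1 / 1000 : ℝ)) → δ ≤ 1 / 2 →
            ∀ h : ℕ, 1 ≤ h → (h : ℝ) ≤ A * x ^ (1 + 1 / 3999 : ℝ) →
              |(∑ n ∈ Icc 1 ⌊2 * x⌋₊,
                  plateauCutoff (1 + δ) (2 - δ) δ (n / x) * (Λ n * Λ (n + h))) -
                  x * (∫ u, plateauCutoff (1 + δ) (2 - δ) δ u) * goldbachSingularSeries h *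
                    (1 + if Nat.totient (2 ^ padicValNat 2 q) ∣ h then
                          (-1 : ℝ) ^ (h / Nat.totient (2 ^ padicValNat 2 q)) *
                            ∏ p ∈ (q / 2 ^ padicValNat 2 q).primeFactors.filter (fun p => ¬ p ∣ h),
                              (-1 : ℝ) / ((p : ℝ) - 2)
                        else 0)| ≤
                K * ((h : ℝ) / (Nat.totient h : ℝ)) * x *
                  (Real.exp (-C * Real.sqrt (Real.log x / Real.log q * Real.log η)) +
                    Real.exp (-c₀ * Real.sqrt (Real.log x)) +
                    Real.log x / Real.log q * Real.log η ^ (6 : ℕ) / η) := by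
  intro C hC A hA
  obtain ⟨η₀, K₁, hK₁, H₁⟩ := Hcore C hC A hA
  obtain ⟨Ke, hKe, He⟩ := exists_rpow_neg_le_mul_exp_sqrt (show (0 : ℝ) < 1 / 1000 by norm_num) c₀
  exact smoothed_of_core_generic (R := fun x => Real.exp (-c₀ * Real.sqrt (Real.log x))) hA
    (fun x _ => (Real.exp_pos _).le) hKe He hK₁ H₁

/-- **Corollary 1.1(i) from the CORE regime of the classical smoothed form of Theorem 1.3**: compose
`MatomakiMerikoski2023_smoothed_classical_of_core` with `MatomakiMerikoski2023_fixedShift_of_smoothed_classical`.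
[cite: MatomakiMerikoski2023, Corollary 1.1(i), §2, §7 and the deduction after Theorem 1.4] -/
theorem MatomakiMerikoski2023_fixedShift_of_core_classical {c₀ : ℝ} (hc₀ : 0 < c₀)
    (Hcore : ∀ C : ℝ, 1 ≤ C → ∀ A : ℝ, 0 < A → ∃ η₀ K : ℝ, 0 < K ∧
      ∀ (q : ℕ) [NeZero q], 3 ≤ q → ∀ χ : DirichletCharacter ℂ q, χ.IsPrimitive → χ.IsQuadratic →
        ∀ η : ℝ, 10 ≤ η → η₀ ≤ η → χ.LFunction ((1 - 1 / (η * Real.log q) : ℝ) : ℂ) = 0 →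
          ∀ x : ℝ, (q : ℝ) ^ (37 / 4 : ℝ) ≤ x → Real.log x / Real.log q * Real.log η ^ (6 : ℕ) / η ≤ 1 →
            ∀ δ : ℝ, x ^ (-(1 / 999 : ℝ)) / 4 ≤ δ → δ ≤ x ^ (-(1 / 1000 : ℝ)) → δ ≤ 1 / 2 →
            ∀ h : ℕ, 1 ≤ h → Even h → (h : ℝ) ≤ A * x ^ (1 + 1 / 3999 : ℝ) →
              |(∑ n ∈ Icc 1 ⌊2 * x⌋₊,
                  plateauCutoff (1 + δ) (2 - δ) δ (n / x) * (Λ n * Λ (n + h))) -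
                  x * (∫ u, plateauCutoff (1 + δ) (2 - δ) δ u) * goldbachSingularSeries h *
                    (1 + if Nat.totient (2 ^ padicValNat 2 q) ∣ h then
                          (-1 : ℝ) ^ (h / Nat.totient (2 ^ padicValNat 2 q)) *
                            ∏ p ∈ (q / 2 ^ padicValNat 2 q).primeFactors.filter (fun p => ¬ p ∣ h),
                              (-1 : ℝ) / ((p : ℝ) - 2)
                        else 0)| ≤
                K * ((h : ℝ) / (Nat.totient h : ℝ)) * x *
                  (Real.exp (-C * Real.sqrt (Real.log x / Real.log q * Real.log η)) +
                    Real.exp (-c₀ * Real.sqrt (Real.log x)) +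
                    Real.log x / Real.log q * Real.log η ^ (6 : ℕ) / η)) :
    MatomakiMerikoski2023_fixedShift :=
  MatomakiMerikoski2023_fixedShift_of_smoothed_classical hc₀
    (MatomakiMerikoski2023_smoothed_classical_of_core Hcore)

/-- **Corollary 1.1(ii) from the classical smoothed dyadic form of Theorem 1.3**: compose
`MatomakiMerikoski2023_pairCorrelation_classical_of_smoothed'` (constant `c₀/2`) with
`MatomakiMerikoski2023_fixedShift_ii_of_pairCorrelation_classical` (`SiegelZeroPrimePairsFixedShiftII.lean`).
[cite: MatomakiMerikoski2023, Corollary 1.1(ii), §2 and the deduction after Theorem 1.4] -/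
theorem MatomakiMerikoski2023_fixedShift_ii_of_smoothed_classical {c₀ : ℝ} (hc₀ : 0 < c₀)
    (H : ∀ C : ℝ, 1 ≤ C → ∀ A : ℝ, 0 < A → ∃ K : ℝ, 0 < K ∧
      ∀ (q : ℕ) [NeZero q], 3 ≤ q → ∀ χ : DirichletCharacter ℂ q, χ.IsPrimitive → χ.IsQuadratic →
        ∀ η : ℝ, 10 ≤ η → χ.LFunction ((1 - 1 / (η * Real.log q) : ℝ) : ℂ) = 0 →
          ∀ x : ℝ, (q : ℝ) ^ (37 / 4 : ℝ) ≤ x →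
            ∀ δ : ℝ, x ^ (-(1 / 999 : ℝ)) / 4 ≤ δ → δ ≤ x ^ (-(1 / 1000 : ℝ)) → δ ≤ 1 / 2 →
            ∀ h : ℕ, 1 ≤ h → (h : ℝ) ≤ A * x ^ (1 + 1 / 3999 : ℝ) →
              |(∑ n ∈ Icc 1 ⌊2 * x⌋₊,
                  plateauCutoff (1 + δ) (2 - δ) δ (n / x) * (Λ n * Λ (n + h))) -
                  x * (∫ u, plateauCutoff (1 + δ) (2 - δ) δ u) * goldbachSingularSeries h *
                    (1 + if Nat.totient (2 ^ padicValNat 2 q) ∣ h then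
                          (-1 : ℝ) ^ (h / Nat.totient (2 ^ padicValNat 2 q)) *
                            ∏ p ∈ (q / 2 ^ padicValNat 2 q).primeFactors.filter (fun p => ¬ p ∣ h),
                              (-1 : ℝ) / ((p : ℝ) - 2)
                        else 0)| ≤
                K * ((h : ℝ) / (Nat.totient h : ℝ)) * x *
                  (Real.exp (-C * Real.sqrt (Real.log x / Real.log q * Real.log η)) +
                    Real.exp (-c₀ * Real.sqrt (Real.log x)) +
                    Real.log x / Real.log q * Real.log η ^ (6 : ℕ) / η)) :
    MatomakiMerikoski2023_fixedShift_ii :=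
  MatomakiMerikoski2023_fixedShift_ii_of_pairCorrelation_classical (half_pos hc₀)
    (MatomakiMerikoski2023_pairCorrelation_classical_of_smoothed' hc₀ H)

/-- **Corollary 1.1(ii) from the CORE regime of the classical smoothed form of Theorem 1.3**: compose
`MatomakiMerikoski2023_smoothed_classical_of_core` with `MatomakiMerikoski2023_fixedShift_ii_of_smoothed_classical`.
[cite: MatomakiMerikoski2023, Corollary 1.1(ii), §2, §7 and the deduction after Theorem 1.4] -/
theorem MatomakiMerikoski2023_fixedShift_ii_of_core_classical {c₀ : ℝ} (hc₀ : 0 < c₀)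
    (Hcore : ∀ C : ℝ, 1 ≤ C → ∀ A : ℝ, 0 < A → ∃ η₀ K : ℝ, 0 < K ∧
      ∀ (q : ℕ) [NeZero q], 3 ≤ q → ∀ χ : DirichletCharacter ℂ q, χ.IsPrimitive → χ.IsQuadratic →
        ∀ η : ℝ, 10 ≤ η → η₀ ≤ η → χ.LFunction ((1 - 1 / (η * Real.log q) : ℝ) : ℂ) = 0 →
          ∀ x : ℝ, (q : ℝ) ^ (37 / 4 : ℝ) ≤ x → Real.log x / Real.log q * Real.log η ^ (6 : ℕ) / η ≤ 1 →
            ∀ δ : ℝ, x ^ (-(1 / 999 : ℝ)) / 4 ≤ δ → δ ≤ x ^ (-(1 / 1000 : ℝ)) → δ ≤ 1 / 2 →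
            ∀ h : ℕ, 1 ≤ h → Even h → (h : ℝ) ≤ A * x ^ (1 + 1 / 3999 : ℝ) →
              |(∑ n ∈ Icc 1 ⌊2 * x⌋₊,
                  plateauCutoff (1 + δ) (2 - δ) δ (n / x) * (Λ n * Λ (n + h))) -
                  x * (∫ u, plateauCutoff (1 + δ) (2 - δ) δ u) * goldbachSingularSeries h *
                    (1 + if Nat.totient (2 ^ padicValNat 2 q) ∣ h then
                          (-1 : ℝ) ^ (h / Nat.totient (2 ^ padicValNat 2 q)) *
                            ∏ p ∈ (q / 2 ^ padicValNat 2 q).primeFactors.filter (fun p => ¬ p ∣ h),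
                              (-1 : ℝ) / ((p : ℝ) - 2)
                        else 0)| ≤
                K * ((h : ℝ) / (Nat.totient h : ℝ)) * x *
                  (Real.exp (-C * Real.sqrt (Real.log x / Real.log q * Real.log η)) +
                    Real.exp (-c₀ * Real.sqrt (Real.log x)) +
                    Real.log x / Real.log q * Real.log η ^ (6 : ℕ) / η)) :
    MatomakiMerikoski2023_fixedShift_ii :=
  MatomakiMerikoski2023_fixedShift_ii_of_smoothed_classical hc₀
    (MatomakiMerikoski2023_smoothed_classical_of_core Hcore)

end Literature.Barriers.Parity

end
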